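import Literature.Computability.Cryptography.HashAndSignOTS
import Literature.Computability.Cryptography.SignaturesFirstAnswer
import Literature.Computability.Cryptography.LamportOTSSecurity
import Literature.Computability.Complexity.OracleOneQuery
import HarnessLib

/-!
# Security of one-time hash-and-sign (Goldreich, Prop. 6.4.31, furthermore-part)

[Goldreich 2004] O. Goldreich, *Foundations of Cryptography, Vol. 2: Basic Applications*, Cambridge
University Press, 2004, §6.4.3.3 ("The hash-and-sign paradigm, revisited"): Construction 6.4.30 and
Proposition 6.4.31 (pp. 565–568), Corollary 6.4.6. [cite: Goldreich2004, Prop. 6.4.31]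

## Main results (all proved; no named facts)

* `HashSign.isOneTimeSecure` — **Prop. 6.4.31, furthermore-part**: if `(G, S, V)` is a secure
  `ℓ`-restricted ONE-TIME signature scheme (`S.IsRestrictedOneTimeSecure ℓ`, Def. 6.4.3) and `{h_s}`
  is a universal one-way hash family (`H.IsUOWHF ℓ'`, Def. 6.4.18) with `ℓ(n) = 2n + 2 + ℓ'(n)`,
  indices of length `n` on the range of `I(1ⁿ)` and explicit polynomial coin budgets
  (`c_I = p_I`, `c_S = p_S`, `c_G = p_K`), then for a suitable polynomial signing-coin budget `CL`
  Construction 6.4.30 `HashSign.scheme H S pI pS CL` (`HashAndSignOTS.lean`) is a secure one-time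
  signature scheme (`SignatureScheme.IsOneTimeSecure`).
* `HashSign.exists_isOneTimeSecure_of_OWFExist_of_isUOWHF` — with Cor. 6.4.6
  (`Lamport.scheme_isRestrictedOneTimeSecure`): one-way functions and a UOWHF (polynomial range
  specifier, indices of length `n`) give a secure one-time signature scheme — the one-time level of
  Goldreich's route to Theorem 6.4.32 / 6.4.1 (the remaining printed steps, UOWHF from OWF — Rompel 1990,
  Thm 6.4.29 — and one-time ⇒ general via authentication trees, Cor. 6.4.17, are not formalised here).

## The proof (the printed one, `pp. 566–568`)

Fix a PPT one-time forger `A'` against `S'`. Per coins — key coins `r₀`, forger coins `r_A`, and the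
signing coins `ρ` of the (at most one) answer — the attack is deterministic (`HashSign.Atk.*`), and by
`SignatureScheme.cmaExp_toReal_eq_uniformAvg_of_le_one_exact` (the one-query factorisation of
`SignaturesFirstAnswer.lean`, here with the EXACT coin length `firstCoinLen` of the first query, since
the signing coins of `S'` grow with the document) the forging probability is the triple uniform average
of the forgery indicator (`Pr.forgeProb_eq`). Every forgery falls under **Case 1** (the `S`-signed value
`⟨β₁', h_{β₁'}(α')⟩` of the forgery differs from that of the query) or **Case 2** (it coincides: then
`β₁' = β₁`, `α' ≠ α₁` and `h_{β₁}(α') = h_{β₁}(α₁)`, a designated collision under the index `β₁`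
chosen AFTER `α₁`) — `Atk.forge_cases`; hence `Pr ≤ P₁ + P₂` (`Pr.forgeProb_le_P1_add_P2`).

* Case 1 — the forger `A` against `(G, S, V)` (`HashSign.FA.forger`, a ONE-query oracle algorithm
  assembled from FP stages by `OracleAlg.oneQueryPair`, `OracleOneQuery.lean`): on `⟨1ⁿ, pk⟩` it
  samples `β₁ ← I(1ⁿ)` from its own coins, finds `A'`'s first query `α₁` (`OracleAlg.firstQueryFn`),
  asks the single query `⟨β₁, h_{β₁}(α₁)⟩`, answers `A'` with `⟨β₁, β₂⟩` and finishes the emulation in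
  FP (`OracleAlg.simPairFn`), outputting `(⟨β₁', h_{β₁'}(α')⟩, β₂')`. Faithfulness:
  `FA.forgeA_of_case1` / `FA.forgeA_of_case1_noquery`; PPT: `FA.forger_isPPT`; probability:
  `Pr.P1_le` (`P₁ ≤` the `ℓ`-restricted one-time forging probability of `A`, by splitting `A`'s coins
  into `r_A`, the index coins and padding, and cutting `S`'s signing coins to the single answer,
  `FA.forgeA_iff_take`).
* Case 2 — the collision finder `(A₀, B')` (`HashSign.FB.A0`, `HashSign.FB.finder`): the target coins
  `r ← U_{q(n)}` encode `r₀ r_A ρ_S`; `A₀(r) = α₁` (Stage 1, in FP: `FB.A0_mem_FP`, reading `n` off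
  `|r| = q(n)` by a clocked search `FB.nOfFn`); given the external index `s`, `B'` answers `A'`'s query
  with `⟨s, S_{sk}(⟨s, h_s(α₁)⟩; ρ_S)⟩` and outputs `α'` (Stage 3). Faithfulness:
  `FB.collision_of_case2`; PPT: `FB.finder_isPPT`; probability: `Pr.P2_le` (`P₂ ≤ tcrProb`, the
  index coins of the signer playing the external `I(1ⁿ)`, `Atk.case2_iff_take`).
* Both bounds are negligible (`hS`, `hH`), hence so is their sum (`HashSign.isOneTimeSecure`, with the
  budget polynomials of `HashSign.Bud`).

## Deviations (documented)

As in `HashAndSignOTS.lean`: keys tagged with `1ⁿ`, the pair CODE `⟨β₁, h_{β₁}(α)⟩` (so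
`ℓ(n) = 2n + 2 + ℓ'(n)`), the extra check `|β₁| = n` in `V'`, and explicit polynomial coin budgets
(the reductions split uniform coin strings between `G`, `A'`, `I` and `S`). The theorem produces the
signing-coin budget `CL` existentially (a polynomial built from output-length polynomials of `I`, `h`,
`G`, `HashSign.Bud.CP`). `B'` answers EVERY emulated query with the same pair; this is faithful on the
one-query runs that matter and immaterial otherwise.
-/

/-! ## Prop. 6.4.31 (furthermore-part): the one-time attack on `S'` and its two cases -/

namespace Literature.Computability.Cryptography

open Filter Asymptotics _root_.Computability Complexity Finset Polynomial
open Complexity.Brick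

namespace HashSign

variable (H : HashCollection) (S : SignatureScheme) (pI pS : Polynomial ℕ) (CL : ℕ → ℕ)
  (A' : OracleAdversary (List Bool × List Bool))

/-! ### The real one-time attack on `S'`, run deterministically per coins -/

namespace Atk

/-- The verification key of `S` on key coins `r₀`. [folklore] -/
def pk (n : ℕ) (r₀ : List Bool) : List Bool := (S.keyGen.run n r₀).1

/-- The signing key of `S` on key coins `r₀`. [folklore] -/
def sk (n : ℕ) (r₀ : List Bool) : List Bool := (S.keyGen.run n r₀).2

/-- The verification key of `S'`: `⟨1ⁿ, pk⟩`. [Goldreich 2004, Construction 6.4.30] [cite: Goldreich2004, Construction 6.4.30] -/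
def pk' (n : ℕ) (r₀ : List Bool) : List Bool := boolPair (ones n) (pk S n r₀)

/-- The signing key of `S'`: `⟨1ⁿ, sk⟩`. [Goldreich 2004, Construction 6.4.30] [cite: Goldreich2004, Construction 6.4.30] -/
def sk' (n : ℕ) (r₀ : List Bool) : List Bool := boolPair (ones n) (sk S n r₀)

/-- The keys of `S'` on key coins `r₀` (definitional). [folklore] -/
theorem keyGen'_run (n : ℕ) (r₀ : List Bool) : (scheme H S pI pS CL).keyGen.run n r₀ = (pk' S n r₀, sk' S n r₀) := rfl

/-- The forger's game input `⟨1ⁿ, pk'⟩`. [Goldreich 2004, Def. 6.4.2] [cite: Goldreich2004, Def. 6.4.2] -/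
def xA' (n : ℕ) (r₀ : List Bool) : List Bool := boolPair (unaryEncodeNat n) (pk' S n r₀)

/-- The forger's round budget. [folklore] -/
def T' (n : ℕ) (r₀ : List Bool) : ℕ := A'.fuel.eval (xA' S n r₀).length

/-- The forger's coin budget. [folklore] -/
def cA (n : ℕ) (r₀ : List Bool) : ℕ := A'.coins.eval (xA' S n r₀).length

/-- The deterministic signing oracle of `S'` with signing coins `ρ`. [Goldreich 2004, §6.1.3] [folklore] -/
def O' (n : ℕ) (r₀ ρ : List Bool) : Oracle := (scheme H S pI pS CL).sigOracleWith (sk' S n r₀) ρ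

/-- The queries of the attack. [Goldreich 2004, Def. 6.4.2] [cite: Goldreich2004, Def. 6.4.2] -/
def qs (n : ℕ) (r₀ rA ρ : List Bool) : List (List Bool) :=
  A'.alg.queries (O' H S pI pS CL n r₀ ρ) (T' S A' n r₀) (boolPair (xA' S n r₀) rA)

/-- The output of the attack. [Goldreich 2004, Def. 6.4.2] [cite: Goldreich2004, Def. 6.4.2] -/
def out (n : ℕ) (r₀ rA ρ : List Bool) : Option (List Bool × List Bool) :=
  A'.alg.run (O' H S pI pS CL n r₀ ρ) (T' S A' n r₀) (boolPair (xA' S n r₀) rA)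

/-- The one-time forgery event of the attack on `S'`, per coins. [Goldreich 2004, Def. 6.4.2] [cite: Goldreich2004, Def. 6.4.2] -/
def Forge (n : ℕ) (r₀ rA ρ : List Bool) : Prop :=
  (pk' S n r₀, qs H S pI pS CL A' n r₀ rA ρ, out H S pI pS CL A' n r₀ rA ρ) ∈ (scheme H S pI pS CL).oneTimeForgeEvent

/-- The hash index used by the signer of `S'` with signing coins `ρ`: `β₁ = I(1ⁿ; ρ ↾ p_I(n))`. [Goldreich 2004,
Construction 6.4.30] [cite: Goldreich2004, Construction 6.4.30] -/
def b1 (n : ℕ) (ρ : List Bool) : List Bool := H.index.run n (ρ.take (pI.eval n))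

/-- `beta1` of the tagged signing key is `b1`. [folklore] -/
theorem beta1_sk' (n : ℕ) (r₀ ρ : List Bool) : beta1 H pI (sk' S n r₀) ρ = b1 H pI n ρ := by
  simp [beta1, sk', b1]

/-- The value `S` signs when `S'` answers the query `α₁`: `m₁ = ⟨β₁, h_{β₁}(α₁)⟩`. [Goldreich 2004, proof of
Prop. 6.4.31] [cite: Goldreich2004, Prop. 6.4.31] -/
def m1 (n : ℕ) (ρ α₁ : List Bool) : List Bool := hashedMsg H (b1 H pI n ρ) α₁

/-- The value `S`-signed inside a forged `S'`-signature `σ' = ⟨β₁', β₂'⟩` of `α'`: `⟨β₁', h_{β₁'}(α')⟩`.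
[Goldreich 2004, proof of Prop. 6.4.31 ("`α₂ = (β₁, h_{β₁}(α))`")] [cite: Goldreich2004, Prop. 6.4.31] -/
def mOf (α' σ' : List Bool) : List Bool := hashedMsg H (fstF σ') α'

/-- **Case 1** of the proof: a one-time forgery `(α', σ')` whose `S`-signed value differs from that of the
(at most one) query. [Goldreich 2004, proof of Prop. 6.4.31, Case 1] [cite: Goldreich2004, Prop. 6.4.31] -/
def Case1 (n : ℕ) (r₀ rA ρ : List Bool) : Prop :=
  ∃ α' σ', out H S pI pS CL A' n r₀ rA ρ = some (α', σ') ∧ verify' H S (pk' S n r₀) α' σ' = true ∧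
    (qs H S pI pS CL A' n r₀ rA ρ).length ≤ 1 ∧
    ∀ α₁ ∈ qs H S pI pS CL A' n r₀ rA ρ, mOf H α' σ' ≠ m1 H pI n ρ α₁

/-- **Case 2** of the proof: the forgery re-uses the `S`-signed value of the query `α₁ ≠ α'`, i.e. forms a
designated collision `h_{β₁}(α') = h_{β₁}(α₁)` under the index `β₁` chosen AFTER `α₁`. [Goldreich 2004,
proof of Prop. 6.4.31, Case 2] [cite: Goldreich2004, Prop. 6.4.31] -/
def Case2 (n : ℕ) (r₀ rA ρ : List Bool) : Prop :=
  ∃ α₁ α' σ', qs H S pI pS CL A' n r₀ rA ρ = [α₁] ∧ out H S pI pS CL A' n r₀ rA ρ = some (α', σ') ∧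
    α' ≠ α₁ ∧ fstF σ' = b1 H pI n ρ ∧ H.hash (b1 H pI n ρ) α' = H.hash (b1 H pI n ρ) α₁

/-- `boolPair` is injective in both arguments. [folklore] -/
theorem boolPair_inj' {a₁ a₂ c₁ c₂ : List Bool} (h : boolPair a₁ c₁ = boolPair a₂ c₂) : a₁ = a₂ ∧ c₁ = c₂ := by
  have h1 := congrArg boolUnpair h
  rw [boolUnpair_boolPair, boolUnpair_boolPair, Prod.mk.injEq] at h1
  exact h1

/-- **Every one-time forgery against `S'` falls under Case 1 or Case 2.** [Goldreich 2004, proof of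
Prop. 6.4.31 ("We consider the following two cases")] [cite: Goldreich2004, Prop. 6.4.31] -/
theorem forge_cases {n : ℕ} {r₀ rA ρ : List Bool} (h : Forge H S pI pS CL A' n r₀ rA ρ) :
    Case1 H S pI pS CL A' n r₀ rA ρ ∨ Case2 H S pI pS CL A' n r₀ rA ρ := by
  obtain ⟨⟨α', σ', hout, hver, hnot⟩, hlen⟩ := h
  dsimp only at hout hver hnot hlen
  by_cases hc : ∀ α₁ ∈ qs H S pI pS CL A' n r₀ rA ρ, mOf H α' σ' ≠ m1 H pI n ρ α₁
  · exact Or.inl ⟨α', σ', hout, hver, hlen, hc⟩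
  · push Not at hc
    obtain ⟨α₁, hα₁, heq⟩ := hc
    right
    -- the single query is `α₁`
    have hqs : qs H S pI pS CL A' n r₀ rA ρ = [α₁] := by
      rcases hq : qs H S pI pS CL A' n r₀ rA ρ with _ | ⟨q, _ | ⟨q', rest⟩⟩
      · rw [hq] at hα₁; simp at hα₁
      · rw [hq] at hα₁; simp at hα₁; rw [hα₁]
      · rw [hq] at hlen; simp at hlen
    refine ⟨α₁, α', σ', hqs, hout, fun h' => hnot (by rw [h', hqs]; exact List.mem_singleton_self _), ?_⟩
    have h2 := boolPair_inj' heq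
    refine ⟨h2.1, ?_⟩
    have h3 := h2.2
    rw [h2.1] at h3
    exact h3

/-- In Case 1 the forged `S'`-signature carries an `S`-signature accepted by `V` on a value of the restricted
length, provided `h` has range specifier `ℓ'` and `ℓ(n) = 2n + 2 + ℓ'(n)`. [Goldreich 2004, proof of
Prop. 6.4.31, Case 1] [cite: Goldreich2004, Prop. 6.4.31] -/
theorem case1_verify {ℓ ℓ' : ℕ → ℕ} (hℓ : ∀ n, ℓ n = 2 * n + 2 + ℓ' n) (hR : H.HasRange ℓ') {n : ℕ} {r₀ : List Bool}
    {α' σ' : List Bool} (hver : verify' H S (pk' S n r₀) α' σ' = true) :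
    S.verify (pk S n r₀) (mOf H α' σ') (sndF σ') = true ∧ (mOf H α' σ').length = ℓ n := by
  simp only [verify', pk', fstF_boolPair, sndF_boolPair, List.length_replicate, Bool.and_eq_true, decide_eq_true_eq] at hver
  exact ⟨hver.2, by rw [mOf, hℓ, length_hashedMsg H hR hver.1]⟩

end Atk

end HashSign

end Literature.Computability.Cryptography

/-! ## The forger `A` against the length-restricted scheme `S` -/

namespace Literature.Computability.Cryptography

open Filter Asymptotics _root_.Computability Complexity Finset Polynomial
open Complexity.Brick

namespace HashSign

variable (H : HashCollection) (S : SignatureScheme) (pI pS : Polynomial ℕ) (CL : ℕ → ℕ)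
  (A' : OracleAdversary (List Bool × List Bool))

namespace FA

/-! ### The stages of `A`, as functions of its machine input `w = ⟨⟨1ⁿ, pk⟩, r⟩` -/

/-- `1ⁿ` (the first field of `A`'s game input `⟨1ⁿ, pk⟩`). [folklore] -/
def uOf (w : List Bool) : List Bool := fstF (fstF w)

/-- `n`. [folklore] -/
def nOf (w : List Bool) : ℕ := (uOf w).length

/-- `A'`'s game input in the emulation: `⟨1ⁿ, ⟨1ⁿ, pk⟩⟩`. [Goldreich 2004, proof of Prop. 6.4.31] [cite: Goldreich2004, Prop. 6.4.31] -/
def xE (w : List Bool) : List Bool := boolPair (uOf w) (boolPair (uOf w) (sndF (fstF w)))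

/-- `A'`'s coins: the first `c_{A'}(|x_E|)` of `A`'s coins. [folklore] -/
def rE (w : List Bool) : List Bool := (sndF w).take (A'.coins.eval (xE w).length)

/-- The index sampler's coins: the next `p_I(n)` of `A`'s coins. [folklore] -/
def rI (w : List Bool) : List Bool := ((sndF w).drop (A'.coins.eval (xE w).length)).take (pI.eval (nOf w))

/-- The hash index `β₁ = I(1ⁿ; r_I)` chosen by `A`. [Goldreich 2004, proof of Prop. 6.4.31 ("`A` generates
`a₁ ← I(1ⁿ)`")] [cite: Goldreich2004, Prop. 6.4.31] -/
def b1E (w : List Bool) : List Bool := H.index.run (nOf w) (rI pI A' w)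

/-- `A'`'s machine input `⟨x_E, r_E⟩`. [folklore] -/
def preE (w : List Bool) : List Bool := boolPair (xE w) (rE A' w)

/-- Stage `D`: does `A'` ask? [folklore] -/
def D : List Bool → List Bool := OracleAlg.asksFirstFn A'.alg (preE A')

/-- `A'`'s first query `α₁`. [folklore] -/
noncomputable def a1E : List Bool → List Bool := OracleAlg.firstQueryFn A'.alg (preE A')

/-- Stage `Q`: the single query `m₁ = ⟨β₁, h_{β₁}(α₁)⟩`. [Goldreich 2004, proof of Prop. 6.4.31 ("forwards
`(a₁, h_{a₁}(q))` to its own oracle")] [cite: Goldreich2004, Prop. 6.4.31] -/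
noncomputable def Q (w : List Bool) : List Bool := hashedMsg H (b1E H pI A' w) (a1E A' w)

/-- The emulation's input map after the answer: `w₁ = ⟨w, β₂⟩ ↦ preE w`. [folklore] -/
def preE1 : List Bool → List Bool := preE A' ∘ fstF

/-- The emulation's answer rule after the answer `β₂`: every emulated query gets `⟨β₁, β₂⟩` (only the first
matters on one-time events). [Goldreich 2004, proof of Prop. 6.4.31 ("answers with `(a₁, a₂)`")]
[cite: Goldreich2004, Prop. 6.4.31] -/
def ans1 : List Bool → List Bool := fun z => boolPair (b1E H pI A' (fstF (fstF z))) (sndF (fstF z))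

/-- The output re-coding: `A'`'s forgery `⟨α', ⟨β₁', β₂'⟩⟩ ↦ ⟨⟨β₁', h_{β₁'}(α')⟩, β₂'⟩`. [Goldreich 2004,
proof of Prop. 6.4.31 ("`A` will output `(α₂, β₂)`, where `α₂ = (β₁, h_{β₁}(α))`")] [cite: Goldreich2004, Prop. 6.4.31] -/
def post (e : List Bool) : List Bool := boolPair (hashedMsg H (fstF (sndF e)) (fstF e)) (sndF (sndF e))

/-- Stage `Out₁`: finish the emulation with the answer and re-code. [folklore] -/
noncomputable def Out1 (c R : Polynomial ℕ) : List Bool → List Bool :=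
  post H ∘ OracleAlg.simPairFn A'.alg (preE1 A') (ans1 H pI A') c R

/-- Stage `Out₀`: `A'` asked nothing; finish the (query-free) emulation and re-code. [folklore] -/
noncomputable def Out0 (c R : Polynomial ℕ) : List Bool → List Bool :=
  post H ∘ OracleAlg.simPairFn A'.alg (preE A') (fun _ => []) c R

/-- **The forger `A`** against `S`: a one-query oracle adversary with coin budget `coins` and two rounds.
[Goldreich 2004, proof of Prop. 6.4.31 (the adversary `A`)] [cite: Goldreich2004, Prop. 6.4.31] -/
noncomputable def forger (c R coins : Polynomial ℕ) : OracleAdversary (List Bool × List Bool) :=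
  ⟨OracleAlg.oneQueryPair (D A') (Q H pI A') (Out0 H A' c R) (Out1 H pI A' c R), coins, C 2⟩

/-! ### `A`'s run on genuine inputs -/

section Genuine

variable {H S pI pS CL A'}
variable {n : ℕ} {r₀ rA rIc pad : List Bool}

/-- `A`'s machine input in `S`'s experiment: `⟨⟨1ⁿ, pk⟩, r_A r_I pad⟩`. [folklore] -/
def gen (S : SignatureScheme) (n : ℕ) (r₀ rA rIc pad : List Bool) : List Bool :=
  boolPair (boolPair (unaryEncodeNat n) (Atk.pk S n r₀)) (rA ++ rIc ++ pad)

/-- `uOf` of a genuine input. [folklore] -/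
theorem uOf_gen : uOf (gen S n r₀ rA rIc pad) = unaryEncodeNat n := by simp [uOf, gen]

/-- `nOf` of a genuine input. [folklore] -/
theorem nOf_gen : nOf (gen S n r₀ rA rIc pad) = n := by
  simp [nOf, uOf_gen, Complexity.unaryEncodeNat_eq_replicate]

/-- `xE` of a genuine input is `A'`'s game input. [folklore] -/
theorem xE_gen : xE (gen S n r₀ rA rIc pad) = Atk.xA' S n r₀ := by
  rw [xE, uOf_gen]
  simp only [gen, fstF_boolPair, sndF_boolPair, Atk.xA', Atk.pk', Complexity.unaryEncodeNat_eq_replicate]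

variable (hrA : rA.length = Atk.cA S A' n r₀) (hrI : rIc.length = pI.eval n)
include hrA in
/-- `rE` of a genuine input is `r_A`. [folklore] -/
theorem rE_gen : rE A' (gen S n r₀ rA rIc pad) = rA := by
  rw [rE, xE_gen, gen, sndF_boolPair, List.append_assoc, ← Atk.cA, List.take_left' hrA]

include hrA hrI in
/-- `rI` of a genuine input is the index coins. [folklore] -/
theorem rI_gen : rI pI A' (gen S n r₀ rA rIc pad) = rIc := by
  rw [rI, xE_gen, nOf_gen, gen, sndF_boolPair, List.append_assoc, ← Atk.cA, List.drop_left' hrA, List.take_left' hrI]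

include hrA hrI in
/-- `b1E` of a genuine input is `I(1ⁿ; r_I)`. [folklore] -/
theorem b1E_gen : b1E H pI A' (gen S n r₀ rA rIc pad) = H.index.run n rIc := by
  rw [b1E, nOf_gen, rI_gen hrA hrI]

include hrA in
/-- `preE` of a genuine input is `A'`'s machine input. [folklore] -/
theorem preE_gen : preE A' (gen S n r₀ rA rIc pad) = boolPair (Atk.xA' S n r₀) rA := by
  rw [preE, xE_gen, rE_gen hrA]

end Genuine

end FA

end HashSign

end Literature.Computability.Cryptography

/-! ## Faithfulness of `A`: Case 1 yields a restricted one-time forgery against `S` -/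

namespace Literature.Computability.Cryptography

open Filter Asymptotics _root_.Computability Complexity Finset Polynomial
open Complexity.Brick

namespace HashSign

variable {H : HashCollection} {S : SignatureScheme} {pI pS : Polynomial ℕ} {CL : ℕ → ℕ}
  {A' : OracleAdversary (List Bool × List Bool)}

namespace FA

/-- Two oracles that agree on every query asked during a run produce the same run and transcript (local
copy of `OracleAlg.runAux_queriesAux_congr`, `Complexity/MultilinearExtension.lean`, kept out of the import
graph). [cite: AroraBarak2009, §3.4] -/
theorem runAux_queriesAux_congr {β : Type} (M : OracleAlg β) {O O' : Oracle} (x : List Bool) :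
    ∀ (k : ℕ) (ans : List (List Bool)), (∀ y ∈ M.queriesAux O x k ans, O' y = O y) →
      M.runAux O' x k ans = M.runAux O x k ans ∧ M.queriesAux O' x k ans = M.queriesAux O x k ans
  | 0, _, _ => ⟨rfl, rfl⟩
  | k + 1, ans, h => by
    unfold OracleAlg.runAux OracleAlg.queriesAux
    unfold OracleAlg.queriesAux at h
    cases hs : M.step x ans with
    | inr b => simp
    | inl qy =>
      simp only [hs, List.mem_cons, forall_eq_or_imp] at h
      obtain ⟨hq, hrest⟩ := h
      simp only [hq]
      obtain ⟨h1, h2⟩ := runAux_queriesAux_congr M x k (ans ++ [O qy]) hrest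
      exact ⟨h1, by rw [h2]⟩

/-- On a run with output, the transcript is empty iff the first step is an output. [folklore] -/
theorem queries_eq_nil_iff_step {β : Type} (M : OracleAlg β) (O : Oracle) (x : List Bool) {k : ℕ} {b : β}
    (h : M.run O k x = some b) : M.queries O k x = [] ↔ ∃ b', M.step x [] = Sum.inr b' := by
  cases k with
  | zero => simp [OracleAlg.run, OracleAlg.runAux] at h
  | succ k =>
    simp only [OracleAlg.queries, OracleAlg.queriesAux]
    cases M.step x [] with
    | inl q => simp
    | inr b' => exact ⟨fun _ => ⟨b', rfl⟩, fun _ => rfl⟩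

/-- `beta1` of the tagged key reads the first `p_I(n)` coins. [folklore] -/
theorem beta1_sk'_eq (n : ℕ) (r₀ ρ' : List Bool) : beta1 H pI (Atk.sk' S n r₀) ρ' = H.index.run n (ρ'.take (pI.eval n)) := by
  simp [beta1, Atk.sk']

/-- The answer of `S'`'s signing oracle to `α₁` with signing coins `ρ`, under a sufficient budget: `⟨β₁, β₂⟩` with
`β₁ = I(1ⁿ; ρ ↾ p_I(n))` and `β₂ = S(sk, m₁; (ρ ⇂ p_I(n)) ↾ p_S)`. [Goldreich 2004, Construction 6.4.30]
[cite: Goldreich2004, Construction 6.4.30] -/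
theorem O'_apply (hCL' : ∀ (sk' α ρ : List Bool), pI.eval (fstF sk').length +
      pS.eval (pairCode (sndF sk', hashedMsg H (beta1 H pI sk' ρ) α)).length ≤ CL (pairCode (sk', α)).length)
    (n : ℕ) (r₀ ρ α₁ : List Bool) :
    Atk.O' H S pI pS CL n r₀ ρ α₁ = boolPair (Atk.b1 H pI n ρ)
      (S.sign.run (Atk.sk S n r₀, Atk.m1 H pI n ρ α₁)
        ((ρ.drop (pI.eval n)).take (pS.eval (pairCode (Atk.sk S n r₀, Atk.m1 H pI n ρ α₁)).length))) := by
  have hbud : pI.eval n + pS.eval (pairCode (Atk.sk S n r₀, Atk.m1 H pI n ρ α₁)).length ≤ CL (pairCode (Atk.sk' S n r₀, α₁)).length := by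
    have := hCL' (Atk.sk' S n r₀) α₁ ρ
    rw [beta1_sk'_eq] at this
    simpa [Atk.sk', Atk.m1, Atk.b1] using this
  have h1 : (ρ.take (CL (pairCode (Atk.sk' S n r₀, α₁)).length)).take (pI.eval n) = ρ.take (pI.eval n) := by
    rw [List.take_take, min_eq_left (by omega)]
  have h2 : ((ρ.take (CL (pairCode (Atk.sk' S n r₀, α₁)).length)).drop (pI.eval n)).take
      (pS.eval (pairCode (Atk.sk S n r₀, Atk.m1 H pI n ρ α₁)).length) =
      (ρ.drop (pI.eval n)).take (pS.eval (pairCode (Atk.sk S n r₀, Atk.m1 H pI n ρ α₁)).length) := by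
    rw [List.drop_take, List.take_take, min_eq_left (by omega)]
  unfold Atk.O' SignatureScheme.sigOracleWith
  rw [show (scheme H S pI pS CL).sign.coinLen = CL from rfl]
  show boolPair (beta1 H pI (Atk.sk' S n r₀) _) (beta2 H S pI pS (Atk.sk' S n r₀) α₁ _) = _
  have hb1 : beta1 H pI (Atk.sk' S n r₀) (ρ.take (CL (pairCode (Atk.sk' S n r₀, α₁)).length)) = Atk.b1 H pI n ρ := by
    rw [beta1_sk'_eq, h1, Atk.b1]
  rw [beta2, hb1]
  simp only [Atk.sk', fstF_boolPair, sndF_boolPair, List.length_replicate]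
  rw [show hashedMsg H (Atk.b1 H pI n ρ) α₁ = Atk.m1 H pI n ρ α₁ from rfl]
  rw [show Atk.sk' S n r₀ = boolPair (ones n) (Atk.sk S n r₀) from rfl] at h2
  rw [h2]

section Case1

variable {ℓ ℓ' : ℕ → ℕ} (hℓ : ∀ n, ℓ n = 2 * n + 2 + ℓ' n) (hR : H.HasRange ℓ')
  (hpI : ∀ n, H.index.coinLen n = pI.eval n) (hpS : ∀ k, S.sign.coinLen k = pS.eval k)
  (hlen : ∀ n, ∀ s ∈ (H.indexPMF n).support, s.length = n)
  (hCL' : ∀ (sk' α ρ : List Bool), pI.eval (fstF sk').length +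
    pS.eval (pairCode (sndF sk', hashedMsg H (beta1 H pI sk' ρ) α)).length ≤ CL (pairCode (sk', α)).length)
  {c R : Polynomial ℕ}
  (hR' : ∀ (n : ℕ) (r₀ rA rIc pad : List Bool) (β₂ : List Bool), Atk.T' S A' n r₀ ≤ R.eval (gen S n r₀ rA rIc pad).length ∧
    Atk.T' S A' n r₀ ≤ R.eval (boolPair (gen S n r₀ rA rIc pad) β₂).length)
  (hc : ∀ (n : ℕ) (r₀ rA rIc pad : List Bool) (β₂ : List Bool), ∀ q, A'.alg.step (boolPair (Atk.xA' S n r₀) rA) [] = Sum.inl q →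
    q.length ≤ c.eval (gen S n r₀ rA rIc pad).length ∧ q.length ≤ c.eval (boolPair (gen S n r₀ rA rIc pad) β₂).length)

variable {n : ℕ} {r₀ rA ρ pad : List Bool} (hrA : rA.length = Atk.cA S A' n r₀) (hρ : pI.eval n ≤ ρ.length)

include hpI hlen hρ in
/-- The index chosen by the signer has length `n`. [folklore] -/
theorem length_b1 : (Atk.b1 H pI n ρ).length = n := by
  apply hlen n
  rw [HashCollection.indexPMF, RandAlg.outputPMF, PMF.support_map]
  have hl : (ρ.take (pI.eval n)).length = H.index.coinLen (unaryEncodeNat n).length := by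
    rw [List.length_take, Complexity.unaryEncodeNat_eq_replicate, List.length_replicate, hpI]; omega
  exact ⟨⟨ρ.take (pI.eval n), hl⟩, by rw [PMF.support_uniformOfFintype]; exact Set.mem_univ _, rfl⟩

include hℓ hR hpI hpS hlen hCL' hR' hc hrA hρ in
/-- **Case 1 yields a restricted one-time forgery of `A` against `S`**, with `A`'s coins `r_A (ρ ↾ p_I(n)) pad`
and `S`'s signing coins `ρ ⇂ p_I(n)` (so that `A`'s single answer is the `β₂` inside `S'`'s answer).
[Goldreich 2004, proof of Prop. 6.4.31, Case 1 ("the document-signature pair `((β₁, h_{β₁}(α)), β₂)`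
constitutes a success in existential forgery relative to the `ℓ`-restricted scheme")]
[cite: Goldreich2004, Prop. 6.4.31] -/
theorem forgeA_of_case1 (hcase : Atk.Case1 H S pI pS CL A' n r₀ rA ρ) :
    (Atk.pk S n r₀,
      (forger H pI A' c R 0).alg.queries (S.sigOracleWith (Atk.sk S n r₀) (ρ.drop (pI.eval n))) 2 (gen S n r₀ rA (ρ.take (pI.eval n)) pad),
      (forger H pI A' c R 0).alg.run (S.sigOracleWith (Atk.sk S n r₀) (ρ.drop (pI.eval n))) 2 (gen S n r₀ rA (ρ.take (pI.eval n)) pad)) ∈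
      S.restrictedOneTimeForgeEvent ℓ n := by
  obtain ⟨α', σ', hout, hver, hqlen, hne⟩ := hcase
  obtain ⟨hverS, hmlen⟩ := Atk.case1_verify H S hℓ hR hver
  have hrI : (ρ.take (pI.eval n)).length = pI.eval n := by rw [List.length_take]; omega
  have hpre : preE A' (gen S n r₀ rA (ρ.take (pI.eval n)) pad) = boolPair (Atk.xA' S n r₀) rA := preE_gen hrA
  have hb1E : b1E H pI A' (gen S n r₀ rA (ρ.take (pI.eval n)) pad) = Atk.b1 H pI n ρ := by
    rw [b1E_gen hrA hrI, Atk.b1]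
  set w := gen S n r₀ rA (ρ.take (pI.eval n)) pad with hw
  set Osk := S.sigOracleWith (Atk.sk S n r₀) (ρ.drop (pI.eval n)) with hOsk
  rw [SignatureScheme.mem_restrictedOneTimeForgeEvent_iff]
  -- does `A'` ask?
  by_cases hD : D A' w = [true]
  · -- `A'` asks `α₁`: `A` asks `m₁` and emulates `A'` with the answer
    obtain ⟨α₁, hstep⟩ := (OracleAlg.asksFirstFn_eq_true_iff _ _ _).1 hD
    rw [hpre] at hstep
    have hT : 0 < Atk.T' S A' n r₀ := by
      rcases Nat.eq_zero_or_pos (Atk.T' S A' n r₀) with h0 | h0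
      · rw [Atk.out, h0] at hout; simp [OracleAlg.run, OracleAlg.runAux] at hout
      · exact h0
    -- the real transcript is `[α₁]`
    have hqs : Atk.qs H S pI pS CL A' n r₀ rA ρ = [α₁] := by
      have hne' : Atk.qs H S pI pS CL A' n r₀ rA ρ ≠ [] := fun h0 => by
        obtain ⟨b', hb'⟩ := (queries_eq_nil_iff_step _ _ _ hout).1 h0
        rw [hstep] at hb'; cases hb'
      rcases hq : Atk.qs H S pI pS CL A' n r₀ rA ρ with _ | ⟨q, _ | ⟨q', rest⟩⟩
      · exact absurd hq hne'
      · have : q = α₁ := by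
          obtain ⟨k, hk⟩ := Nat.exists_eq_add_of_lt hT
          rw [Atk.qs, hk, Nat.zero_add, OracleAlg.queries, OracleAlg.queriesAux, hstep] at hq
          simp only [List.cons.injEq] at hq
          exact hq.1.symm
        rw [this]
      · rw [hq] at hqlen; simp at hqlen
    have ha1 : a1E A' w = α₁ := by
      rw [a1E]
      refine OracleAlg.firstQueryFn_eq (Atk.O' H S pI pS CL n r₀ ρ) (n := Atk.T' S A' n r₀) (qs := []) ?_
      rw [hpre]; exact hqs
    have hQ : Q H pI A' w = Atk.m1 H pI n ρ α₁ := by rw [Q, hb1E, ha1, Atk.m1]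
    -- `A`'s run: one query `m₁`, answered `β₂`
    set β₂ := Osk (Atk.m1 H pI n ρ α₁) with hβ₂
    have hrunA := OracleAlg.run_oneQueryPair_pos (D A') (Q H pI A') (Out0 H A' c R) (Out1 H pI A' c R) Osk hD 0
    have hqsA := OracleAlg.queries_oneQueryPair_pos (D A') (Q H pI A') (Out0 H A' c R) (Out1 H pI A' c R) Osk hD 0
    rw [Nat.zero_add] at hrunA hqsA
    rw [show (forger H pI A' c R 0).alg = OracleAlg.oneQueryPair (D A') (Q H pI A') (Out0 H A' c R) (Out1 H pI A' c R) from rfl,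
      hrunA, hqsA, hQ]
    -- the emulation after the answer is the real run
    have hans : ∀ q, ans1 H pI A' (boolPair (boolPair w β₂) q) = Atk.O' H S pI pS CL n r₀ ρ α₁ := by
      intro q
      rw [ans1, fstF_boolPair, fstF_boolPair, sndF_boolPair, hb1E, O'_apply hCL', hβ₂, hOsk, SignatureScheme.sigOracleWith, hpS]
    have hreal_run : A'.alg.run (fun q => ans1 H pI A' (boolPair (boolPair w β₂) q)) (Atk.T' S A' n r₀) (boolPair (Atk.xA' S n r₀) rA) =
        some (α', σ') := by
      rw [← hout, Atk.out]
      refine (runAux_queriesAux_congr A'.alg (boolPair (Atk.xA' S n r₀) rA) _ [] fun y hy => ?_).1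
      rw [show A'.alg.queriesAux _ _ _ [] = Atk.qs H S pI pS CL A' n r₀ rA ρ from rfl, hqs, List.mem_singleton] at hy
      rw [hy, hans]
    have hreal_qs : A'.alg.queries (fun q => ans1 H pI A' (boolPair (boolPair w β₂) q)) (Atk.T' S A' n r₀) (boolPair (Atk.xA' S n r₀) rA) = [α₁] := by
      rw [← hqs, Atk.qs]
      refine (runAux_queriesAux_congr A'.alg (boolPair (Atk.xA' S n r₀) rA) _ [] fun y hy => ?_).2
      rw [show A'.alg.queriesAux _ _ _ [] = Atk.qs H S pI pS CL A' n r₀ rA ρ from rfl, hqs, List.mem_singleton] at hy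
      rw [hy, hans]
    have hemu : OracleAlg.simPairFn A'.alg (preE1 A') (ans1 H pI A') c R (boolPair w β₂) = boolPair α' σ' := by
      refine OracleAlg.simPairFn_eq_of_run (b := (α', σ')) ?_ ?_
      · rw [preE1, Function.comp_apply, fstF_boolPair, hpre]
        exact OracleAlg.run_mono _ _ _ (hR' n r₀ rA (ρ.take (pI.eval n)) pad β₂).2 hreal_run
      · intro q hq
        rw [preE1, Function.comp_apply, fstF_boolPair, hpre,
          OracleAlg.queries_eq_of_run_eq_some _ _ _ (hR' n r₀ rA (ρ.take (pI.eval n)) pad β₂).2 hreal_run, hreal_qs,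
          List.mem_singleton] at hq
        rw [hq]
        exact (hc n r₀ rA (ρ.take (pI.eval n)) pad β₂ α₁ hstep).2
    have hOut1 : Out1 H pI A' c R (boolPair w β₂) = boolPair (Atk.mOf H α' σ') (sndF σ') := by
      rw [Out1, Function.comp_apply, hemu, post, fstF_boolPair, sndF_boolPair, Atk.mOf]
    rw [hOut1, fstF_boolPair, sndF_boolPair]
    refine ⟨Atk.mOf H α' σ', sndF σ', rfl, hverS, ?_, hmlen, by simp, ?_⟩
    · rw [List.mem_singleton]; exact hne α₁ (by rw [hqs]; exact List.mem_singleton_self _)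
    · intro q hq
      rw [List.mem_singleton] at hq
      rw [hq, Atk.m1, hℓ, length_hashedMsg H hR (length_b1 hpI hlen hρ)]
  · -- `A'` asks nothing: `A` outputs the re-coded forgery at once
    have hstep : ∃ b', A'.alg.step (boolPair (Atk.xA' S n r₀) rA) [] = Sum.inr b' := by
      cases hs : A'.alg.step (preE A' w) [] with
      | inl q => exact absurd ((OracleAlg.asksFirstFn_eq_true_iff _ _ _).2 ⟨q, hs⟩) hD
      | inr b' => rw [hpre] at hs; exact ⟨b', hs⟩
    have hqs : Atk.qs H S pI pS CL A' n r₀ rA ρ = [] := (queries_eq_nil_iff_step _ _ _ hout).2 hstep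
    have hrunA := OracleAlg.run_oneQueryPair_neg (D A') (Q H pI A') (Out0 H A' c R) (Out1 H pI A' c R) Osk hD 1
    have hqsA := OracleAlg.queries_oneQueryPair_neg (D A') (Q H pI A') (Out0 H A' c R) (Out1 H pI A' c R) Osk hD 1
    rw [show (forger H pI A' c R 0).alg = OracleAlg.oneQueryPair (D A') (Q H pI A') (Out0 H A' c R) (Out1 H pI A' c R) from rfl,
      hrunA, hqsA]
    have hreal_run : A'.alg.run (fun q => (fun _ => ([] : List Bool)) (boolPair w q)) (Atk.T' S A' n r₀) (boolPair (Atk.xA' S n r₀) rA) =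
        some (α', σ') := by
      rw [← hout, Atk.out]
      refine (runAux_queriesAux_congr A'.alg (boolPair (Atk.xA' S n r₀) rA) _ [] fun y hy => ?_).1
      rw [show A'.alg.queriesAux _ _ _ [] = Atk.qs H S pI pS CL A' n r₀ rA ρ from rfl, hqs] at hy
      simp at hy
    have hreal_qs : A'.alg.queries (fun q => (fun _ => ([] : List Bool)) (boolPair w q)) (Atk.T' S A' n r₀) (boolPair (Atk.xA' S n r₀) rA) = [] := by
      rw [← hqs, Atk.qs]
      refine (runAux_queriesAux_congr A'.alg (boolPair (Atk.xA' S n r₀) rA) _ [] fun y hy => ?_).2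
      rw [show A'.alg.queriesAux _ _ _ [] = Atk.qs H S pI pS CL A' n r₀ rA ρ from rfl, hqs] at hy
      simp at hy
    have hemu : OracleAlg.simPairFn A'.alg (preE A') (fun _ => []) c R w = boolPair α' σ' := by
      refine OracleAlg.simPairFn_eq_of_run (b := (α', σ')) ?_ ?_
      · rw [hpre]
        exact OracleAlg.run_mono _ _ _ (hR' n r₀ rA (ρ.take (pI.eval n)) pad []).1 hreal_run
      · intro q hq
        rw [hpre, OracleAlg.queries_eq_of_run_eq_some _ _ _ (hR' n r₀ rA (ρ.take (pI.eval n)) pad []).1 hreal_run, hreal_qs] at hq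
        simp at hq
    have hOut0 : Out0 H A' c R w = boolPair (Atk.mOf H α' σ') (sndF σ') := by
      rw [Out0, Function.comp_apply, hemu, post, fstF_boolPair, sndF_boolPair, Atk.mOf]
    rw [hOut0, fstF_boolPair, sndF_boolPair]
    exact ⟨Atk.mOf H α' σ', sndF σ', rfl, hverS, by simp, hmlen, by simp, by simp⟩

include hℓ hR hR' hrA in
/-- **Case 1 without a query yields a restricted one-time forgery of `A`** for ANY index coins `r_I`, padding and
signing coins (`A` outputs the re-coded forgery at once). [Goldreich 2004, proof of Prop. 6.4.31, Case 1]
[cite: Goldreich2004, Prop. 6.4.31] -/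
theorem forgeA_of_case1_noquery (hcase : Atk.Case1 H S pI pS CL A' n r₀ rA ρ)
    (hstep : ∃ b', A'.alg.step (boolPair (Atk.xA' S n r₀) rA) [] = Sum.inr b') (rIc pad ρS : List Bool) :
    (Atk.pk S n r₀,
      (forger H pI A' c R 0).alg.queries (S.sigOracleWith (Atk.sk S n r₀) ρS) 2 (gen S n r₀ rA rIc pad),
      (forger H pI A' c R 0).alg.run (S.sigOracleWith (Atk.sk S n r₀) ρS) 2 (gen S n r₀ rA rIc pad)) ∈
      S.restrictedOneTimeForgeEvent ℓ n := by
  obtain ⟨α', σ', hout, hver, -, -⟩ := hcase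
  obtain ⟨hverS, hmlen⟩ := Atk.case1_verify H S hℓ hR hver
  have hpre : preE A' (gen S n r₀ rA rIc pad) = boolPair (Atk.xA' S n r₀) rA := preE_gen hrA
  set w := gen S n r₀ rA rIc pad with hw
  set Osk := S.sigOracleWith (Atk.sk S n r₀) ρS with hOsk
  rw [SignatureScheme.mem_restrictedOneTimeForgeEvent_iff]
  have hD : ¬ D A' w = [true] := fun h => by
    obtain ⟨q, hq⟩ := (OracleAlg.asksFirstFn_eq_true_iff _ _ _).1 h
    obtain ⟨b', hb'⟩ := hstep
    rw [hpre, hb'] at hq; cases hq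
  have hqs : Atk.qs H S pI pS CL A' n r₀ rA ρ = [] := (queries_eq_nil_iff_step _ _ _ hout).2 hstep
  have hrunA := OracleAlg.run_oneQueryPair_neg (D A') (Q H pI A') (Out0 H A' c R) (Out1 H pI A' c R) Osk hD 1
  have hqsA := OracleAlg.queries_oneQueryPair_neg (D A') (Q H pI A') (Out0 H A' c R) (Out1 H pI A' c R) Osk hD 1
  rw [show (forger H pI A' c R 0).alg = OracleAlg.oneQueryPair (D A') (Q H pI A') (Out0 H A' c R) (Out1 H pI A' c R) from rfl,
    hrunA, hqsA]
  have hreal_run : A'.alg.run (fun q => (fun _ => ([] : List Bool)) (boolPair w q)) (Atk.T' S A' n r₀) (boolPair (Atk.xA' S n r₀) rA) =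
      some (α', σ') := by
    rw [← hout, Atk.out]
    refine (runAux_queriesAux_congr A'.alg (boolPair (Atk.xA' S n r₀) rA) _ [] fun y hy => ?_).1
    rw [show A'.alg.queriesAux _ _ _ [] = Atk.qs H S pI pS CL A' n r₀ rA ρ from rfl, hqs] at hy
    simp at hy
  have hreal_qs : A'.alg.queries (fun q => (fun _ => ([] : List Bool)) (boolPair w q)) (Atk.T' S A' n r₀) (boolPair (Atk.xA' S n r₀) rA) = [] := by
    rw [← hqs, Atk.qs]
    refine (runAux_queriesAux_congr A'.alg (boolPair (Atk.xA' S n r₀) rA) _ [] fun y hy => ?_).2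
    rw [show A'.alg.queriesAux _ _ _ [] = Atk.qs H S pI pS CL A' n r₀ rA ρ from rfl, hqs] at hy
    simp at hy
  have hemu : OracleAlg.simPairFn A'.alg (preE A') (fun _ => []) c R w = boolPair α' σ' := by
    refine OracleAlg.simPairFn_eq_of_run (b := (α', σ')) ?_ ?_
    · rw [hpre]
      exact OracleAlg.run_mono _ _ _ (hR' n r₀ rA rIc pad []).1 hreal_run
    · intro q hq
      rw [hpre, OracleAlg.queries_eq_of_run_eq_some _ _ _ (hR' n r₀ rA rIc pad []).1 hreal_run, hreal_qs] at hq
      simp at hq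
  have hOut0 : Out0 H A' c R w = boolPair (Atk.mOf H α' σ') (sndF σ') := by
    rw [Out0, Function.comp_apply, hemu, post, fstF_boolPair, sndF_boolPair, Atk.mOf]
  rw [hOut0, fstF_boolPair, sndF_boolPair]
  exact ⟨Atk.mOf H α' σ', sndF σ', rfl, hverS, by simp, hmlen, by simp, by simp⟩

end Case1

end FA

end HashSign

end Literature.Computability.Cryptography

/-! ## The designated-collision finder `B'` and its initial stage `A₀` -/

namespace Literature.Computability.Cryptography

open Filter Asymptotics _root_.Computability Complexity Finset Polynomial
open Complexity.Brick

namespace HashSign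

variable (H : HashCollection) (S : SignatureScheme) (pI pS pK q : Polynomial ℕ) (CL : ℕ → ℕ)
  (A' : OracleAdversary (List Bool × List Bool))

namespace FB

/-! ### Reading the parameter off the length of the target coins -/

/-- The parameter `n` recovered from the length `L = q(n)` of the target coins: the largest `m ≤ L` with
`q(m) ≤ L` (cf. `SigOWF.Ctx.nOf`). [folklore] -/
def nOfLen (L : ℕ) : ℕ := Nat.findGreatest (fun m => q.eval m ≤ L) L

/-- `nOfLen (q n) = n` for a strictly increasing `q` with `q(n) ≥ n`. [folklore] -/
theorem nOfLen_eval (hq : StrictMono fun n => q.eval n) (hqn : ∀ n, n ≤ q.eval n) (n : ℕ) : nOfLen q (q.eval n) = n := by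
  unfold nOfLen
  apply le_antisymm
  · by_contra h
    push Not at h
    have h1 : q.eval n < q.eval (Nat.findGreatest (fun m => q.eval m ≤ q.eval n) (q.eval n)) := hq h
    have h2 : q.eval (Nat.findGreatest (fun m => q.eval m ≤ q.eval n) (q.eval n)) ≤ q.eval n :=
      Nat.findGreatest_spec (P := fun m => q.eval m ≤ q.eval n) (hqn n) le_rfl
    omega
  · exact Nat.le_findGreatest (hqn n) le_rfl

/-! ### The stages, as functions of the target coins `r` and of `B'`'s input `⟨1ⁿ, ⟨s, r⟩⟩` -/

/-- The parameter read off the target coins. [folklore] -/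
def nR (r : List Bool) : ℕ := nOfLen q r.length

/-- The key-generation coins `r₀ = r ↾ p_K(n)`. [Goldreich 2004, proof of Prop. 6.4.31 (Stage 1: "`B'` selects
`(s, v) ← G'(1ⁿ)`")] [cite: Goldreich2004, Prop. 6.4.31] -/
def r0R (r : List Bool) : List Bool := r.take (pK.eval (nR q r))

/-- `A'`'s game input `⟨1ⁿ, ⟨1ⁿ, pk⟩⟩` in `B'`'s emulation. [folklore] -/
def xR (r : List Bool) : List Bool := Atk.xA' S (nR q r) (r0R pK q r)

/-- `A'`'s coins in `B'`'s emulation: the next `c_{A'}(|x|)` target coins. [folklore] -/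
def rAR (r : List Bool) : List Bool := (r.drop (pK.eval (nR q r))).take (A'.coins.eval (xR S pK q r).length)

/-- `S`'s signing coins in `B'`'s emulation: the target coins after `r₀ r_A`. [folklore] -/
def rSR (r : List Bool) : List Bool := r.drop (pK.eval (nR q r) + A'.coins.eval (xR S pK q r).length)

/-- `A'`'s machine input in `B'`'s emulation (a function of the target coins only). [folklore] -/
def preR (r : List Bool) : List Bool := boolPair (xR S pK q r) (rAR S pK q A' r)

/-- **The initial adversary `A₀`**: the first query `α₁` of `A'` on the instance generated from the target coins
(Stage 1 of `B'`, which does not see the hash index). [Goldreich 2004, proof of Prop. 6.4.31 (Stage 1: "The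
`i`-th query of `A'` … will be used as the designated pre-image")] [cite: Goldreich2004, Prop. 6.4.31] -/
noncomputable def A0 : List Bool → List Bool := OracleAlg.firstQueryFn A'.alg (preR S pK q A')

/-- The target coins `r` read off `B'`'s machine input `z = ⟨⟨1ⁿ, ⟨s, r⟩⟩, coins⟩`. [folklore] -/
def rZ (z : List Bool) : List Bool := sndF (sndF (fstF z))

/-- The external hash index `s` read off `B'`'s input. [folklore] -/
def sZ (z : List Bool) : List Bool := fstF (sndF (fstF z))

/-- `A'`'s machine input in `B'`'s emulation, from `B'`'s input. [folklore] -/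
def preB : List Bool → List Bool := preR S pK q A' ∘ rZ

/-- The value `S` signs in `B'`'s answer: `m = ⟨s, h_s(α₁)⟩`. [Goldreich 2004, proof of Prop. 6.4.31 (Stage 3:
"answers the `i`-th query by applying `S_s` to the pair `(r, h_r(α⁽ⁱ⁾))`")] [cite: Goldreich2004, Prop. 6.4.31] -/
noncomputable def mB (z : List Bool) : List Bool := hashedMsg H (sZ z) (A0 S pK q A' (rZ z))

/-- `B'`'s answer to every emulated query: `⟨s, S(sk, m; ρ_S)⟩`. [Goldreich 2004, proof of Prop. 6.4.31 (Stage 3)]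
[cite: Goldreich2004, Prop. 6.4.31] -/
noncomputable def ansB : List Bool → List Bool := fun zz =>
  boolPair (sZ (fstF zz)) (S.sign.run (Atk.sk S (nR q (rZ (fstF zz))) (r0R pK q (rZ (fstF zz))), mB H S pK q A' (fstF zz))
    ((rSR S pK q A' (rZ (fstF zz))).take (pS.eval (pairCode (Atk.sk S (nR q (rZ (fstF zz))) (r0R pK q (rZ (fstF zz))), mB H S pK q A' (fstF zz))).length)))

/-- **`B'`'s output**: the forged document `α'` of the emulated `A'`. [Goldreich 2004, proof of Prop. 6.4.31
(Stage 3: "`B'` outputs `α`")] [cite: Goldreich2004, Prop. 6.4.31] -/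
noncomputable def outB (c R : Polynomial ℕ) : List Bool → List Bool :=
  fstF ∘ OracleAlg.simPairFn A'.alg (preB S pK q A') (ansB H S pS pK q A') c R

/-- **The collision finder `B'`** as a (coinless) `RandAlg`. [Goldreich 2004, proof of Prop. 6.4.31 (algorithm `B'`)]
[cite: Goldreich2004, Prop. 6.4.31] -/
noncomputable def finder (c R : Polynomial ℕ) : RandAlg (List Bool) (List Bool) :=
  ⟨fun inp coins => outB H S pS pK q A' c R (boolPair inp coins), fun _ => 0⟩

/-! ### Genuine target coins -/

section Genuine

variable {S pI pS pK q CL A'}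
variable (hq : StrictMono fun n => q.eval n) (hqn : ∀ n, n ≤ q.eval n)
variable {n : ℕ} {r₀ rA rest : List Bool} (hr₀ : r₀.length = pK.eval n) (hrA : rA.length = Atk.cA S A' n r₀)
  (hL : (r₀ ++ rA ++ rest).length = q.eval n)

include hq hqn hL in
/-- `nR` of genuine target coins. [folklore] -/
theorem nR_gen : nR q (r₀ ++ rA ++ rest) = n := by rw [nR, hL, nOfLen_eval q hq hqn]

include hq hqn hr₀ hL in
/-- `r0R` of genuine target coins is `r₀`. [folklore] -/
theorem r0R_gen : r0R pK q (r₀ ++ rA ++ rest) = r₀ := by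
  rw [r0R, nR_gen hq hqn hL, List.append_assoc, List.take_left' hr₀]

include hq hqn hr₀ hL in
/-- `xR` of genuine target coins is `A'`'s game input. [folklore] -/
theorem xR_gen : xR S pK q (r₀ ++ rA ++ rest) = Atk.xA' S n r₀ := by
  rw [xR, nR_gen hq hqn hL, r0R_gen hq hqn hr₀ hL]

include hq hqn hr₀ hrA hL in
/-- `rAR` of genuine target coins is `r_A`. [folklore] -/
theorem rAR_gen : rAR S pK q A' (r₀ ++ rA ++ rest) = rA := by
  rw [rAR, nR_gen hq hqn hL, xR_gen hq hqn hr₀ hL, List.append_assoc, List.drop_left' hr₀, ← Atk.cA, List.take_left' hrA]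

include hq hqn hr₀ hrA hL in
/-- `rSR` of genuine target coins is the rest. [folklore] -/
theorem rSR_gen : rSR S pK q A' (r₀ ++ rA ++ rest) = rest := by
  rw [rSR, nR_gen hq hqn hL, xR_gen hq hqn hr₀ hL, ← Atk.cA, ← List.drop_drop, List.append_assoc, List.drop_left' hr₀,
    List.drop_left' hrA]

include hq hqn hr₀ hrA hL in
/-- `preR` of genuine target coins is `A'`'s machine input. [folklore] -/
theorem preR_gen : preR S pK q A' (r₀ ++ rA ++ rest) = boolPair (Atk.xA' S n r₀) rA := by
  rw [preR, xR_gen hq hqn hr₀ hL, rAR_gen hq hqn hr₀ hrA hL]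

end Genuine

/-! ### Faithfulness: Case 2 yields a designated collision -/

section Case2

variable {H S pI pS pK q CL A'}
variable (hCL' : ∀ (sk' α ρ : List Bool), pI.eval (fstF sk').length +
    pS.eval (pairCode (sndF sk', hashedMsg H (beta1 H pI sk' ρ) α)).length ≤ CL (pairCode (sk', α)).length)
  (hq : StrictMono fun n => q.eval n) (hqn : ∀ n, n ≤ q.eval n)
  {c R : Polynomial ℕ}
  (hR' : ∀ (n : ℕ) (s r : List Bool), r.length = q.eval n → ∀ r₀ : List Bool, r₀.length = pK.eval n →
    Atk.T' S A' n r₀ ≤ R.eval (boolPair (boolPair (unaryEncodeNat n) (boolPair s r)) ([] : List Bool)).length)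
  (hc : ∀ (n : ℕ) (s r : List Bool), r.length = q.eval n → ∀ r₀ : List Bool, r₀.length = pK.eval n →
    ∀ rA : List Bool, rA.length = Atk.cA S A' n r₀ → ∀ qy : List Bool, A'.alg.step (boolPair (Atk.xA' S n r₀) rA) [] = Sum.inl qy →
      qy.length ≤ c.eval (boolPair (boolPair (unaryEncodeNat n) (boolPair s r)) ([] : List Bool)).length)

variable {n : ℕ} {r₀ rA ρ rest : List Bool} (hr₀ : r₀.length = pK.eval n) (hrA : rA.length = Atk.cA S A' n r₀)
  (hL : (r₀ ++ rA ++ (ρ.drop (pI.eval n) ++ rest)).length = q.eval n)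
  (hρ : ∀ α₁, A'.alg.step (boolPair (Atk.xA' S n r₀) rA) [] = Sum.inl α₁ →
    pI.eval n + pS.eval (pairCode (Atk.sk S n r₀, Atk.m1 H pI n ρ α₁)).length ≤ ρ.length)

include hCL' hq hqn hR' hc hr₀ hrA hL hρ in
/-- **Case 2 yields a designated collision for `(A₀, B')`** with target coins `r = r₀ r_A (ρ ⇂ p_I(n)) rest` and
external index `s = β₁ = I(1ⁿ; ρ ↾ p_I(n))`: `A₀(r) = α₁`, `B'(1ⁿ, s, r) = α' ≠ α₁` and `h_s(α') = h_s(α₁)`.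
[Goldreich 2004, proof of Prop. 6.4.31 (Stage 3: "in doing so it has succeeded in forming a designated
collision (with `α⁽ⁱ⁾` under `h_r`)")] [cite: Goldreich2004, Prop. 6.4.31] -/
theorem collision_of_case2 (hcase : Atk.Case2 H S pI pS CL A' n r₀ rA ρ) :
    H.IsDesignatedCollision (Atk.b1 H pI n ρ, A0 S pK q A' (r₀ ++ rA ++ (ρ.drop (pI.eval n) ++ rest)),
      (finder H S pS pK q A' c R).run (boolPair (unaryEncodeNat n) (boolPair (Atk.b1 H pI n ρ) (r₀ ++ rA ++ (ρ.drop (pI.eval n) ++ rest)))) []) := by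
  obtain ⟨α₁, α', σ', hqs, hout, hne, -, hcoll⟩ := hcase
  set r := r₀ ++ rA ++ (ρ.drop (pI.eval n) ++ rest) with hr
  set s := Atk.b1 H pI n ρ with hs
  have hpre : preR S pK q A' r = boolPair (Atk.xA' S n r₀) rA := preR_gen hq hqn hr₀ hrA hL
  -- Stage 1: `A₀(r) = α₁`
  have hA0 : A0 S pK q A' r = α₁ := by
    rw [A0]
    refine OracleAlg.firstQueryFn_eq (Atk.O' H S pI pS CL n r₀ ρ) (n := Atk.T' S A' n r₀) (qs := []) ?_
    rw [hpre]; exact hqs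
  -- the first step of `A'` is the query `α₁`
  have hT : 0 < Atk.T' S A' n r₀ := by
    rcases Nat.eq_zero_or_pos (Atk.T' S A' n r₀) with h0 | h0
    · rw [Atk.out, h0] at hout; simp [OracleAlg.run, OracleAlg.runAux] at hout
    · exact h0
  have hstep : A'.alg.step (boolPair (Atk.xA' S n r₀) rA) [] = Sum.inl α₁ := by
    obtain ⟨k, hk⟩ := Nat.exists_eq_add_of_lt hT
    have hq' := hqs
    rw [Atk.qs, hk, Nat.zero_add, OracleAlg.queries, OracleAlg.queriesAux] at hq'
    cases hs' : A'.alg.step (boolPair (Atk.xA' S n r₀) rA) [] with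
    | inr b => rw [hs'] at hq'; simp at hq'
    | inl qy => rw [hs'] at hq'; simp only [List.cons.injEq] at hq'; rw [hq'.1]
  -- Stage 3: the emulated run with the answer `⟨s, β₂⟩` is the real run
  set z := boolPair (boolPair (unaryEncodeNat n) (boolPair s r)) ([] : List Bool) with hz
  have hrZ : rZ z = r := by simp [rZ, hz]
  have hsZ : sZ z = s := by simp [sZ, hz]
  have hans : ∀ qy, ansB H S pS pK q A' (boolPair z qy) = Atk.O' H S pI pS CL n r₀ ρ α₁ := by
    intro qy
    rw [FA.O'_apply hCL', ansB, fstF_boolPair, hsZ, hrZ, mB, hsZ, hrZ, hA0, nR_gen hq hqn hL, r0R_gen hq hqn hr₀ hL,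
      rSR_gen hq hqn hr₀ hrA hL]
    show boolPair s (S.sign.run (Atk.sk S n r₀, hashedMsg H s α₁) _) = _
    rw [hs, show hashedMsg H (Atk.b1 H pI n ρ) α₁ = Atk.m1 H pI n ρ α₁ from rfl, List.take_append_of_le_length]
    rw [List.length_drop]
    have := hCL' (Atk.sk' S n r₀) α₁ ρ
    rw [FA.beta1_sk'_eq] at this
    simp only [Atk.sk', fstF_boolPair, sndF_boolPair, List.length_replicate] at this
    have hρ' : pI.eval n + pS.eval (pairCode (Atk.sk S n r₀, Atk.m1 H pI n ρ α₁)).length ≤ ρ.length := hρ α₁ hstep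
    show pS.eval _ ≤ ρ.length - pI.eval n
    simp only [Atk.m1, Atk.b1] at hρ' ⊢
    omega
  have hreal_run : A'.alg.run (fun qy => ansB H S pS pK q A' (boolPair z qy)) (Atk.T' S A' n r₀) (boolPair (Atk.xA' S n r₀) rA) =
      some (α', σ') := by
    rw [← hout, Atk.out]
    refine (FA.runAux_queriesAux_congr A'.alg (boolPair (Atk.xA' S n r₀) rA) _ [] fun y hy => ?_).1
    rw [show A'.alg.queriesAux _ _ _ [] = Atk.qs H S pI pS CL A' n r₀ rA ρ from rfl, hqs, List.mem_singleton] at hy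
    rw [hy, hans]
  have hreal_qs : A'.alg.queries (fun qy => ansB H S pS pK q A' (boolPair z qy)) (Atk.T' S A' n r₀) (boolPair (Atk.xA' S n r₀) rA) = [α₁] := by
    rw [← hqs, Atk.qs]
    refine (FA.runAux_queriesAux_congr A'.alg (boolPair (Atk.xA' S n r₀) rA) _ [] fun y hy => ?_).2
    rw [show A'.alg.queriesAux _ _ _ [] = Atk.qs H S pI pS CL A' n r₀ rA ρ from rfl, hqs, List.mem_singleton] at hy
    rw [hy, hans]
  have hpreB : preB S pK q A' z = boolPair (Atk.xA' S n r₀) rA := by rw [preB, Function.comp_apply, hrZ, hpre]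
  have hemu : OracleAlg.simPairFn A'.alg (preB S pK q A') (ansB H S pS pK q A') c R z = boolPair α' σ' := by
    refine OracleAlg.simPairFn_eq_of_run (b := (α', σ')) ?_ ?_
    · rw [hpreB]
      exact OracleAlg.run_mono _ _ _ (hR' n s r hL r₀ hr₀) hreal_run
    · intro qy hqy
      rw [hpreB, OracleAlg.queries_eq_of_run_eq_some _ _ _ (hR' n s r hL r₀ hr₀) hreal_run, hreal_qs, List.mem_singleton] at hqy
      rw [hqy]
      exact hc n s r hL r₀ hr₀ rA hrA α₁ hstep
  have hB : (finder H S pS pK q A' c R).run (boolPair (unaryEncodeNat n) (boolPair s r)) [] = α' := by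
    show outB H S pS pK q A' c R z = α'
    rw [outB, Function.comp_apply, hemu, fstF_boolPair]
  refine ⟨?_, ?_⟩
  · show H.hash s ((finder H S pS pK q A' c R).run (boolPair (unaryEncodeNat n) (boolPair s r)) []) = H.hash s (A0 S pK q A' r)
    rw [hB, hA0, hs, hcoll]
  · show (finder H S pS pK q A' c R).run (boolPair (unaryEncodeNat n) (boolPair s r)) [] ≠ A0 S pK q A' r
    rw [hB, hA0]; exact hne

end Case2

end FB

end HashSign

end Literature.Computability.Cryptography

/-! ## `A`, `A₀` and `B'` are polynomial-time: brick programs -/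

namespace Literature.Computability.Cryptography

open Filter Asymptotics _root_.Computability Complexity Finset Polynomial
open Complexity.Brick Complexity.Plumb Complexity.OracleCompose Complexity.HashBricks

namespace HashSign

variable (H : HashCollection) (S : SignatureScheme) (pI pS pK q : Polynomial ℕ) (CL : ℕ → ℕ)
  (A' : OracleAdversary (List Bool × List Bool))

/-! ### The forger `A` -/

namespace FA

/-- `uOf` as a brick. [folklore] -/
noncomputable def uF : List Bool → List Bool := fstF ∘ fstF

/-- `xE` as a brick. [folklore] -/
noncomputable def xEF : List Bool → List Bool := fanoutFn uF (fanoutFn uF (sndF ∘ fstF))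

/-- `xEF = xE`. [folklore] -/
theorem xEF_eq : xEF = xE := by
  funext w; simp [xEF, xE, uF, uOf]

/-- `xEF ∈ FP`. [folklore] -/
theorem xEF_mem_FP : xEF ∈ FP :=
  fanoutFn_mem_FP (comp_mem_FP fstF_mem_FP fstF_mem_FP) (fanoutFn_mem_FP (comp_mem_FP fstF_mem_FP fstF_mem_FP) (comp_mem_FP sndF_mem_FP fstF_mem_FP))

/-- `xE ∈ FP`. [folklore] -/
theorem xE_mem_FP : xE ∈ FP := xEF_eq ▸ xEF_mem_FP

/-- `rE` as a brick. [folklore] -/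
noncomputable def rEF : List Bool → List Bool := takeFn ∘ fanoutFn (polyFn A'.coins ∘ xE) sndF

/-- `rEF = rE`. [folklore] -/
theorem rEF_eq : rEF A' = rE A' := by
  funext w; simp [rEF, rE]

/-- `rE ∈ FP`. [folklore] -/
theorem rE_mem_FP : rE A' ∈ FP :=
  rEF_eq A' ▸ comp_mem_FP takeFn_mem_FP (fanoutFn_mem_FP (comp_mem_FP (polyFn_mem_FP _) xE_mem_FP) sndF_mem_FP)

/-- `rI` as a brick. [folklore] -/
noncomputable def rIF : List Bool → List Bool :=
  takeFn ∘ fanoutFn (polyFn pI ∘ uF) (dropFn ∘ fanoutFn (polyFn A'.coins ∘ xE) sndF)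

/-- `rIF = rI`. [folklore] -/
theorem rIF_eq : rIF pI A' = rI pI A' := by
  funext w; simp [rIF, rI, uF, nOf, uOf]

/-- `rI ∈ FP`. [folklore] -/
theorem rI_mem_FP : rI pI A' ∈ FP :=
  rIF_eq pI A' ▸ comp_mem_FP takeFn_mem_FP (fanoutFn_mem_FP (comp_mem_FP (polyFn_mem_FP _) (comp_mem_FP fstF_mem_FP fstF_mem_FP))
    (comp_mem_FP dropFn_mem_FP (fanoutFn_mem_FP (comp_mem_FP (polyFn_mem_FP _) xE_mem_FP) sndF_mem_FP)))

/-- `b1E` as a brick. [folklore] -/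
noncomputable def b1EF : List Bool → List Bool := iFn H ∘ fanoutFn uF (rI pI A')

/-- `b1EF = b1E`. [folklore] -/
theorem b1EF_eq : b1EF H pI A' = b1E H pI A' := by
  funext w; simp [b1EF, b1E, iFn, uF, nOf, uOf]

/-- `b1E ∈ FP`. [folklore] -/
theorem b1E_mem_FP (hI : H.index.IsPolyTime unaryEncodeNat (id : List Bool → List Bool)) : b1E H pI A' ∈ FP :=
  b1EF_eq H pI A' ▸ comp_mem_FP (iFn_mem_FP hI) (fanoutFn_mem_FP (comp_mem_FP fstF_mem_FP fstF_mem_FP) (rI_mem_FP pI A'))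

/-- `preE ∈ FP`. [folklore] -/
theorem preE_mem_FP : preE A' ∈ FP := by
  have : preE A' = fanoutFn xE (rE A') := by funext w; simp [preE]
  rw [this]; exact fanoutFn_mem_FP xE_mem_FP (rE_mem_FP A')

variable (hA' : A'.IsPPT ((encodingList Bool).pairBool (encodingList Bool)))
  (hI : H.index.IsPolyTime unaryEncodeNat (id : List Bool → List Bool))
  (hh : PolyTimeComputable pairCode (id : List Bool → List Bool) (fun p : List Bool × List Bool => H.hash p.1 p.2))

include hA' in
/-- `D ∈ FP`. [folklore] -/
theorem D_mem_FP : D A' ∈ FP := OracleAlg.asksFirstFn_mem_FP hA' (preE_mem_FP A')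

include hA' in
/-- `a1E ∈ FP`. [folklore] -/
theorem a1E_mem_FP : a1E A' ∈ FP := OracleAlg.firstQueryFn_mem_FP hA' (preE_mem_FP A')

include hA' hI hh in
/-- `Q ∈ FP`. [folklore] -/
theorem Q_mem_FP : Q H pI A' ∈ FP := by
  have : Q H pI A' = fanoutFn (b1E H pI A') (hFn H ∘ fanoutFn (b1E H pI A') (a1E A')) := by funext w; simp [Q, hFn, hashedMsg]
  rw [this]
  exact fanoutFn_mem_FP (b1E_mem_FP H pI A' hI) (comp_mem_FP (hFn_mem_FP hh) (fanoutFn_mem_FP (b1E_mem_FP H pI A' hI) (a1E_mem_FP A' hA')))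

include hI in
/-- `ans1 ∈ FP`. [folklore] -/
theorem ans1_mem_FP : ans1 H pI A' ∈ FP := by
  have : ans1 H pI A' = fanoutFn (b1E H pI A' ∘ fstF ∘ fstF) (sndF ∘ fstF) := by funext z; simp [ans1]
  rw [this]
  exact fanoutFn_mem_FP (comp_mem_FP (b1E_mem_FP H pI A' hI) (comp_mem_FP fstF_mem_FP fstF_mem_FP)) (comp_mem_FP sndF_mem_FP fstF_mem_FP)

include hh in
/-- `post ∈ FP`. [folklore] -/
theorem post_mem_FP : post H ∈ FP := by
  have : post H = fanoutFn (fanoutFn (fstF ∘ sndF) (hFn H ∘ fanoutFn (fstF ∘ sndF) fstF)) (sndF ∘ sndF) := by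
    funext e; simp [post, hFn, hashedMsg]
  rw [this]
  exact fanoutFn_mem_FP (fanoutFn_mem_FP (comp_mem_FP fstF_mem_FP sndF_mem_FP)
    (comp_mem_FP (hFn_mem_FP hh) (fanoutFn_mem_FP (comp_mem_FP fstF_mem_FP sndF_mem_FP) fstF_mem_FP))) (comp_mem_FP sndF_mem_FP sndF_mem_FP)

include hA' hI hh in
/-- `Out1 ∈ FP`. [folklore] -/
theorem Out1_mem_FP (c R : Polynomial ℕ) : Out1 H pI A' c R ∈ FP :=
  comp_mem_FP (post_mem_FP H hh) (OracleAlg.simPairFn_mem_FP hA' (comp_mem_FP (preE_mem_FP A') fstF_mem_FP) (ans1_mem_FP H pI A' hI) c R)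

include hA' hh in
/-- `Out0 ∈ FP`. [folklore] -/
theorem Out0_mem_FP (c R : Polynomial ℕ) : Out0 H A' c R ∈ FP :=
  comp_mem_FP (post_mem_FP H hh) (OracleAlg.simPairFn_mem_FP hA' (preE_mem_FP A') (const_mem_FP []) c R)

/-- `post` is pair-shaped. [folklore] -/
theorem post_pair (e : List Bool) : boolPair (fstF (post H e)) (sndF (post H e)) = post H e := by simp [post]

include hA' hI hh in
/-- **The forger `A` is PPT.** [Goldreich 2004, proof of Prop. 6.4.31] [cite: Goldreich2004, Prop. 6.4.31] -/
theorem forger_isPPT (c R coins : Polynomial ℕ) : (forger H pI A' c R coins).IsPPT ((encodingList Bool).pairBool (encodingList Bool)) :=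
  OracleAlg.isPolyTime_oneQueryPair _ _ _ _ (D_mem_FP A' hA') (OracleAlg.oneBit_asksFirstFn _ _) (Q_mem_FP H pI A' hA' hI hh)
    (Out0_mem_FP H A' hA' hh c R) (Out1_mem_FP H pI A' hA' hI hh c R) (fun _ => post_pair H _) (fun _ => post_pair H _)

end FA

/-! ### The collision finder `B'` and `A₀` -/

namespace FB

/-! #### Reading the parameter: a clocked search -/

/-- `q(k+1)` as a polynomial in `k`. [folklore] -/
noncomputable def q1 : Polynomial ℕ := q.comp (X + 1)

/-- `q1` evaluates to `q (k+1)`. [folklore] -/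
@[simp] theorem eval_q1 (k : ℕ) : (q1 q).eval k = q.eval (k + 1) := by simp [q1]

/-- The search step: `k ↦ k + 1` while `q(k+1) ≤ L`. [folklore] -/
def nstep (L k : ℕ) : ℕ := if q.eval (k + 1) ≤ L then k + 1 else k

/-- The stop condition `[|r| + 1 ≤ q(k+1)]` on the state `⟨r, 1ᵏ⟩`. [folklore] -/
noncomputable def nCond : List Bool → List Bool := lenLeFn (q1 q) ∘ fanoutFn sndF (List.cons true ∘ fstF)

/-- One round of the search. [folklore] -/
noncomputable def nRound : List Bool → List Bool := fanoutFn fstF (iteFn (nCond q) sndF (List.cons true ∘ sndF))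

/-- Value of the condition. [folklore] -/
theorem nCond_state (r : List Bool) (k : ℕ) : nCond q (boolPair r (ones k)) = [decide (r.length + 1 ≤ q.eval (k + 1))] := by
  simp [nCond, lenLeFn_boolPair]

/-- Value of the round. [folklore] -/
theorem nRound_state (r : List Bool) (k : ℕ) : nRound q (boolPair r (ones k)) = boolPair r (ones (nstep q r.length k)) := by
  unfold nRound nstep
  rw [fanoutFn_apply, fstF_boolPair]
  by_cases h : q.eval (k + 1) ≤ r.length
  · rw [iteFn_apply_false (by rw [nCond_state, decide_eq_false (by omega)]), if_pos h]
    simp [List.replicate_succ]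
  · rw [iteFn_apply_true (by rw [nCond_state, decide_eq_true (by omega)]), if_neg h]
    simp

/-- Additive growth of the round. [folklore] -/
theorem length_nRound_le (w : List Bool) : (nRound q w).length ≤ w.length + 3 := by
  have h1 := length_boolUnpair_parts_le w
  unfold nRound
  rcases lenLeFn_eq_or (q1 q) (fanoutFn sndF (List.cons true ∘ fstF) w) with h | h
  · rw [fanoutFn_apply, iteFn_apply_true (by simpa [nCond] using h)]
    simp only [length_boolPair, fstF, sndF]; omega
  · rw [fanoutFn_apply, iteFn_apply_false (by simpa [nCond] using h)]
    simp only [length_boolPair, fstF, sndF, Function.comp_apply, List.length_cons]; omega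

/-- **The search computes `nOfLen`**: after `j ≤ L` rounds the counter is `min j (nOfLen L)`. [folklore] -/
theorem iterate_nstep (L : ℕ) : ∀ j, j ≤ L → (nstep q L)^[j] 0 = min j (nOfLen q L)
  | 0, _ => by simp
  | j + 1, hj => by
    rw [Function.iterate_succ_apply', iterate_nstep L j (by omega)]
    have hGm : nOfLen q L ≤ L := Nat.findGreatest_le L
    have hG2 : ∀ m, nOfLen q L < m → m ≤ L → ¬ q.eval m ≤ L := fun m h1 h2 =>
      Nat.findGreatest_is_greatest (P := fun k => q.eval k ≤ L) h1 h2
    unfold nstep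
    by_cases hjG : j < nOfLen q L
    · have hG1 : q.eval (nOfLen q L) ≤ L :=
        Nat.findGreatest_of_ne_zero (P := fun k => q.eval k ≤ L) (m := nOfLen q L) rfl (by omega)
      rw [min_eq_left hjG.le, if_pos ((natPoly_eval_mono q (by omega)).trans hG1), min_eq_left (by omega)]
    · rw [min_eq_right (by omega), if_neg (hG2 _ (Nat.lt_succ_self _) (by omega)), min_eq_right (by omega)]

/-- Rounds of the search on a state. [folklore] -/
theorem iterate_nRound (r : List Bool) : ∀ j, (nRound q)^[j] (boolPair r (ones 0)) = boolPair r (ones ((nstep q r.length)^[j] 0))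
  | 0 => rfl
  | j + 1 => by rw [Function.iterate_succ_apply', iterate_nRound r j, nRound_state, Function.iterate_succ_apply']

/-- **`nOfFn r = 1^{nOfLen |r|}`.** [folklore] -/
noncomputable def nOfFn : List Bool → List Bool :=
  sndF ∘ (fun z => (nRound q)^[X.eval (boolUnpair z).1.length] z) ∘ fanoutFn id (fun _ => [])

/-- Value of `nOfFn`. [folklore] -/
theorem nOfFn_apply (r : List Bool) : nOfFn q r = ones (nOfLen q r.length) := by
  have h := iterate_nRound q r r.length
  rw [iterate_nstep q r.length r.length le_rfl, min_eq_right (show nOfLen q r.length ≤ r.length from Nat.findGreatest_le _)] at h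
  simp only [nOfFn, Function.comp_apply, fanoutFn_apply, id, boolUnpair_boolPair, eval_X]
  rw [show (boolPair r [] : List Bool) = boolPair r (ones 0) from rfl, h, sndF_boolPair]

/-- `nOfFn ∈ FP`. [folklore] -/
theorem nOfFn_mem_FP : nOfFn q ∈ FP :=
  comp_mem_FP sndF_mem_FP (comp_mem_FP
    (iterate_mem_FP (fanoutFn_mem_FP fstF_mem_FP (iteFn_mem_FP
      (comp_mem_FP (lenLeFn_mem_FP _) (fanoutFn_mem_FP sndF_mem_FP (comp_mem_FP (cons_mem_FP true) fstF_mem_FP)))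
      sndF_mem_FP (comp_mem_FP (cons_mem_FP true) sndF_mem_FP))) 3 (length_nRound_le q) X)
    (fanoutFn_mem_FP OracleCompose.id_mem_FP (const_mem_FP [])))

/-! #### The stages of `A₀` and `B'` -/

/-- `fstF (pairCode p) = p.1`. [folklore] -/
@[simp] theorem fstF_pairCode (p : List Bool × List Bool) : fstF (pairCode p) = p.1 := fstF_boolPair _ _

/-- `sndF (pairCode p) = p.2`. [folklore] -/
@[simp] theorem sndF_pairCode (p : List Bool × List Bool) : sndF (pairCode p) = p.2 := sndF_boolPair _ _

/-- `r0R` as a brick. [folklore] -/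
noncomputable def r0RF : List Bool → List Bool := takeFn ∘ fanoutFn (polyFn pK ∘ nOfFn q) id

/-- `r0RF = r0R`. [folklore] -/
theorem r0RF_eq : r0RF pK q = r0R pK q := by
  funext r; simp [r0RF, r0R, nOfFn_apply, nR]

/-- `r0R ∈ FP`. [folklore] -/
theorem r0R_mem_FP : r0R pK q ∈ FP :=
  r0RF_eq pK q ▸ comp_mem_FP takeFn_mem_FP (fanoutFn_mem_FP (comp_mem_FP (polyFn_mem_FP _) (nOfFn_mem_FP q)) OracleCompose.id_mem_FP)

/-- `xR` as a brick: `⟨1ⁿ, ⟨1ⁿ, pk⟩⟩` with `pk = fstF (kgFn ⟨1ⁿ, r₀⟩)`. [folklore] -/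
noncomputable def xRF : List Bool → List Bool :=
  fanoutFn (onesFn ∘ nOfFn q) (fanoutFn (onesFn ∘ nOfFn q) (fstF ∘ SigOWF.kgFn (ctx S) ∘ fanoutFn (nOfFn q) (r0R pK q)))

/-- `xRF = xR`. [folklore] -/
theorem xRF_eq : xRF S pK q = xR S pK q := by
  funext r
  simp only [xRF, fanoutFn_apply, Function.comp_apply, nOfFn_apply, SigOWF.kgFn_boolPair, List.length_replicate, onesFn,
    Complexity.unaryEncodeNat_eq_replicate, xR, Atk.xA', Atk.pk', Atk.pk, nR, fstF_pairCode]
  rfl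

/-- `xR ∈ FP`. [folklore] -/
theorem xR_mem_FP (hK : S.keyGen.IsPolyTime unaryEncodeNat pairCode) : xR S pK q ∈ FP :=
  xRF_eq S pK q ▸ fanoutFn_mem_FP (comp_mem_FP onesFn_mem_FP (nOfFn_mem_FP q)) (fanoutFn_mem_FP (comp_mem_FP onesFn_mem_FP (nOfFn_mem_FP q))
    (comp_mem_FP fstF_mem_FP (comp_mem_FP (SigOWF.kgFn_mem_FP hK.1) (fanoutFn_mem_FP (nOfFn_mem_FP q) (r0R_mem_FP pK q)))))

/-- `rAR ∈ FP`. [folklore] -/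
theorem rAR_mem_FP (hK : S.keyGen.IsPolyTime unaryEncodeNat pairCode) : rAR S pK q A' ∈ FP := by
  have : rAR S pK q A' = takeFn ∘ fanoutFn (polyFn A'.coins ∘ xR S pK q) (dropFn ∘ fanoutFn (polyFn pK ∘ nOfFn q) id) := by
    funext r; simp [rAR, nOfFn_apply, nR]
  rw [this]
  exact comp_mem_FP takeFn_mem_FP (fanoutFn_mem_FP (comp_mem_FP (polyFn_mem_FP _) (xR_mem_FP S pK q hK))
    (comp_mem_FP dropFn_mem_FP (fanoutFn_mem_FP (comp_mem_FP (polyFn_mem_FP _) (nOfFn_mem_FP q)) OracleCompose.id_mem_FP)))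

/-- `rSR ∈ FP`. [folklore] -/
theorem rSR_mem_FP (hK : S.keyGen.IsPolyTime unaryEncodeNat pairCode) : rSR S pK q A' ∈ FP := by
  have : rSR S pK q A' = dropFn ∘ fanoutFn (polyFn A'.coins ∘ xR S pK q) (dropFn ∘ fanoutFn (polyFn pK ∘ nOfFn q) id) := by
    funext r; simp [rSR, nOfFn_apply, nR, List.drop_drop]
  rw [this]
  exact comp_mem_FP dropFn_mem_FP (fanoutFn_mem_FP (comp_mem_FP (polyFn_mem_FP _) (xR_mem_FP S pK q hK))
    (comp_mem_FP dropFn_mem_FP (fanoutFn_mem_FP (comp_mem_FP (polyFn_mem_FP _) (nOfFn_mem_FP q)) OracleCompose.id_mem_FP)))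

/-- `preR ∈ FP`. [folklore] -/
theorem preR_mem_FP (hK : S.keyGen.IsPolyTime unaryEncodeNat pairCode) : preR S pK q A' ∈ FP := by
  have : preR S pK q A' = fanoutFn (xR S pK q) (rAR S pK q A') := by funext r; simp [preR]
  rw [this]; exact fanoutFn_mem_FP (xR_mem_FP S pK q hK) (rAR_mem_FP S pK q A' hK)

variable (hA' : A'.IsPPT ((encodingList Bool).pairBool (encodingList Bool))) (hK : S.keyGen.IsPolyTime unaryEncodeNat pairCode)
  (hSg : S.sign.IsPolyTime pairCode (id : List Bool → List Bool))
  (hh : PolyTimeComputable pairCode (id : List Bool → List Bool) (fun p : List Bool × List Bool => H.hash p.1 p.2))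

include hA' hK in
/-- **`A₀ ∈ FP`.** [Goldreich 2004, proof of Prop. 6.4.31 (Stage 1)] [cite: Goldreich2004, Prop. 6.4.31] -/
theorem A0_mem_FP : A0 S pK q A' ∈ FP := OracleAlg.firstQueryFn_mem_FP hA' (preR_mem_FP S pK q A' hK)

/-- The secret key `sk = sndF (kgFn ⟨1ⁿ, r₀⟩)` as a brick on the target coins. [folklore] -/
noncomputable def skRF : List Bool → List Bool := sndF ∘ SigOWF.kgFn (ctx S) ∘ fanoutFn (nOfFn q) (r0R pK q)

/-- Value of `skRF`. [folklore] -/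
theorem skRF_apply (r : List Bool) : skRF S pK q r = Atk.sk S (nR q r) (r0R pK q r) := by
  simp only [skRF, Function.comp_apply, fanoutFn_apply, nOfFn_apply, SigOWF.kgFn_boolPair, List.length_replicate, Atk.sk, nR, sndF_pairCode]
  rfl

/-- `skRF ∈ FP`. [folklore] -/
theorem skRF_mem_FP (hK : S.keyGen.IsPolyTime unaryEncodeNat pairCode) : skRF S pK q ∈ FP :=
  comp_mem_FP sndF_mem_FP (comp_mem_FP (SigOWF.kgFn_mem_FP hK.1) (fanoutFn_mem_FP (nOfFn_mem_FP q) (r0R_mem_FP pK q)))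

include hA' hK hh in
/-- `mB ∈ FP`. [folklore] -/
theorem mB_mem_FP : mB H S pK q A' ∈ FP := by
  have : mB H S pK q A' = fanoutFn (fstF ∘ sndF ∘ fstF) (hFn H ∘ fanoutFn (fstF ∘ sndF ∘ fstF) (A0 S pK q A' ∘ sndF ∘ sndF ∘ fstF)) := by
    funext z; simp [mB, hFn, hashedMsg, sZ, rZ]
  rw [this]
  have h1 : (fstF ∘ sndF ∘ fstF) ∈ FP := comp_mem_FP fstF_mem_FP (comp_mem_FP sndF_mem_FP fstF_mem_FP)
  exact fanoutFn_mem_FP h1 (comp_mem_FP (hFn_mem_FP hh) (fanoutFn_mem_FP h1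
    (comp_mem_FP (A0_mem_FP S pK q A' hA' hK) (comp_mem_FP sndF_mem_FP (comp_mem_FP sndF_mem_FP fstF_mem_FP)))))

include hA' hK hSg hh in
/-- `ansB ∈ FP`. [folklore] -/
theorem ansB_mem_FP : ansB H S pS pK q A' ∈ FP := by
  have : ansB H S pS pK q A' = fanoutFn (fstF ∘ sndF ∘ fstF ∘ fstF)
      (SigOWF.signFn (ctx S) ∘ fanoutFn (fanoutFn (skRF S pK q ∘ sndF ∘ sndF ∘ fstF ∘ fstF) (mB H S pK q A' ∘ fstF))
        (takeFn ∘ fanoutFn (polyFn pS ∘ fanoutFn (skRF S pK q ∘ sndF ∘ sndF ∘ fstF ∘ fstF) (mB H S pK q A' ∘ fstF))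
          (rSR S pK q A' ∘ sndF ∘ sndF ∘ fstF ∘ fstF))) := by
    funext zz
    simp only [ansB, fanoutFn_apply, Function.comp_apply, SigOWF.signFn_boolPair, polyFn_apply, takeFn_boolPair, List.length_replicate,
      skRF_apply, sZ, rZ]
    rfl
  rw [this]
  refine fanoutFn_mem_FP (comp_mem_FP fstF_mem_FP (comp_mem_FP sndF_mem_FP (comp_mem_FP fstF_mem_FP fstF_mem_FP))) ?_
  have hsk : (skRF S pK q ∘ sndF ∘ sndF ∘ fstF ∘ fstF) ∈ FP :=
    comp_mem_FP (skRF_mem_FP S pK q hK) (comp_mem_FP sndF_mem_FP (comp_mem_FP sndF_mem_FP (comp_mem_FP fstF_mem_FP fstF_mem_FP)))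
  have hm : (mB H S pK q A' ∘ fstF) ∈ FP := comp_mem_FP (mB_mem_FP H S pK q A' hA' hK hh) fstF_mem_FP
  exact comp_mem_FP (SigOWF.signFn_mem_FP (P := ctx S) hSg.1) (fanoutFn_mem_FP (fanoutFn_mem_FP hsk hm)
    (comp_mem_FP takeFn_mem_FP (fanoutFn_mem_FP (comp_mem_FP (polyFn_mem_FP _) (fanoutFn_mem_FP hsk hm))
      (comp_mem_FP (rSR_mem_FP S pK q A' hK) (comp_mem_FP sndF_mem_FP (comp_mem_FP sndF_mem_FP (comp_mem_FP fstF_mem_FP fstF_mem_FP)))))))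

include hA' hK hSg hh in
/-- `outB ∈ FP`. [folklore] -/
theorem outB_mem_FP (c R : Polynomial ℕ) : outB H S pS pK q A' c R ∈ FP :=
  comp_mem_FP fstF_mem_FP (OracleAlg.simPairFn_mem_FP hA'
    (comp_mem_FP (preR_mem_FP S pK q A' hK) (comp_mem_FP sndF_mem_FP (comp_mem_FP sndF_mem_FP fstF_mem_FP))) (ansB_mem_FP H S pS pK q A' hA' hK hSg hh) c R)

include hA' hK hSg hh in
/-- **The collision finder `B'` is PPT.** [Goldreich 2004, proof of Prop. 6.4.31 (algorithm `B'`)]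
[cite: Goldreich2004, Prop. 6.4.31] -/
theorem finder_isPPT (c R : Polynomial ℕ) : IsPPT (finder H S pS pK q A' c R) id := by
  refine ⟨?_, 0, fun _ => by simp [finder]⟩
  refine PolyTimeComputable.of_encode (outB_mem_FP H S pS pK q A' hA' hK hSg hh c R) (fun p : List Bool × List Bool => boolPair p.1 p.2)
    (fun _ => rfl) fun p => ?_
  rfl

end FB

end HashSign

end Literature.Computability.Cryptography

/-! ## One-query events with the exact first-signature coin length -/

namespace Literature.Computability.Cryptography

open Filter Asymptotics _root_.Computability Complexity Finset Polynomial

namespace SignatureScheme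

/-- The number of signing coins of the FIRST query of `𝒜` on the machine input `xr` (zero if the first step
is an output): the exact dimension of the first-answer average. [Goldreich 2004, §6.1.3] [folklore] -/
def firstCoinLen (S : SignatureScheme) (𝒜 : OracleAdversary (List Bool × List Bool)) (sk xr : List Bool) : ℕ :=
  match 𝒜.alg.step xr [] with
  | Sum.inl q => S.sign.coinLen (pairCode (sk, q)).length
  | Sum.inr _ => 0

/-- **The chosen-message experiment on one-query events as a triple finite average, exact form**: as
`cmaExp_toReal_eq_uniformAvg_of_le_one` (`SignaturesFirstAnswer.lean`), but the innermost average runs over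
coin strings of the exact length `firstCoinLen` of the first query actually asked, so no global bound on the
signing coins is needed (the signing coins of Construction 6.4.30 grow with the document).
[Goldreich 2004, Def. 6.4.2 (at most one query) with §6.1.3] [cite: Goldreich2004, Def. 6.4.2] -/
theorem cmaExp_toReal_eq_uniformAvg_of_le_one_exact (S : SignatureScheme) (𝒜 : OracleAdversary (List Bool × List Bool))
    (n : ℕ) (E : Set (List Bool × List (List Bool) × Option (List Bool × List Bool))) [DecidablePred (· ∈ E)]
    (hE : ∀ t ∈ E, t.2.1.length ≤ 1) :
    ((S.cmaExpPMF 𝒜 n).toOuterMeasure E).toReal =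
      uniformAvg (S.keyGen.coinLen (unaryEncodeNat n).length) fun r₀ =>
        uniformAvg (𝒜.coins.eval (boolPair (unaryEncodeNat n) (S.keyGen.run n r₀).1).length) fun r =>
          uniformAvg (S.firstCoinLen 𝒜 (S.keyGen.run n r₀).2 (boolPair (boolPair (unaryEncodeNat n) (S.keyGen.run n r₀).1) r)) fun ρ =>
            if ((S.keyGen.run n r₀).1,
                𝒜.alg.queries (S.sigOracleWith (S.keyGen.run n r₀).2 ρ)
                  (𝒜.fuel.eval (boolPair (unaryEncodeNat n) (S.keyGen.run n r₀).1).length)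
                  (boolPair (boolPair (unaryEncodeNat n) (S.keyGen.run n r₀).1) r),
                𝒜.alg.run (S.sigOracleWith (S.keyGen.run n r₀).2 ρ)
                  (𝒜.fuel.eval (boolPair (unaryEncodeNat n) (S.keyGen.run n r₀).1).length)
                  (boolPair (boolPair (unaryEncodeNat n) (S.keyGen.run n r₀).1) r)) ∈ E then 1 else 0 := by
  classical
  set L := S.keyGen.coinLen (unaryEncodeNat n).length with hL
  set Cn : List Bool → ℕ := fun pk => 𝒜.coins.eval (boolPair (unaryEncodeNat n) pk).length with hCn
  set T : List Bool → ℕ := fun pk => 𝒜.fuel.eval (boolPair (unaryEncodeNat n) pk).length with hT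
  -- Step A: for fixed keys and machine input, the mass of the `E`-section is the `ρ`-average
  have hA : ∀ (ks : List Bool × List Bool) (xr : List Bool),
      ((𝒜.alg.probTranscript (fun m => S.sigPMF ks.2 m) (T ks.1) xr).toOuterMeasure
          {t | (ks.1, t) ∈ E}).toReal =
        uniformAvg (S.firstCoinLen 𝒜 ks.2 xr) fun ρ => if (ks.1, 𝒜.alg.queries (S.sigOracleWith ks.2 ρ) (T ks.1) xr,
          𝒜.alg.run (S.sigOracleWith ks.2 ρ) (T ks.1) xr) ∈ E then 1 else 0 := by
    intro ks xr
    rcases hk : T ks.1 with _ | k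
    · -- no fuel: both sides are the indicator of `([], none)`
      rw [OracleAlg.probTranscript, OracleAlg.probTranscriptAux, PMF.toOuterMeasure_pure_apply]
      have hconst : (fun ρ : List Bool => if (ks.1, 𝒜.alg.queries (S.sigOracleWith ks.2 ρ) 0 xr,
          𝒜.alg.run (S.sigOracleWith ks.2 ρ) 0 xr) ∈ E then (1 : ℝ) else 0) =
          fun _ => if (ks.1, ([] : List (List Bool)), (none : Option (List Bool × List Bool))) ∈ E then 1 else 0 := by
        funext ρ; rfl
      rw [hconst, SigOWF.uniformAvg_const']
      simp only [Set.mem_setOf_eq]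
      split_ifs <;> simp
    · cases hs : 𝒜.alg.step xr [] with
      | inr b =>
        -- immediate output: both sides are the indicator of `([], some b)`
        rw [OracleAlg.probTranscript, OracleAlg.probTranscriptAux, hs]
        simp only [PMF.toOuterMeasure_pure_apply]
        have hconst : (fun ρ : List Bool => if (ks.1, 𝒜.alg.queries (S.sigOracleWith ks.2 ρ) (k + 1) xr,
            𝒜.alg.run (S.sigOracleWith ks.2 ρ) (k + 1) xr) ∈ E then (1 : ℝ) else 0) =
            fun _ => if (ks.1, ([] : List (List Bool)), some b) ∈ E then 1 else 0 := by
          funext ρ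
          simp only [OracleAlg.queries, OracleAlg.run, OracleAlg.queriesAux, OracleAlg.runAux, hs]
        rw [hconst, SigOWF.uniformAvg_const']
        simp only [Set.mem_setOf_eq]
        split_ifs <;> simp
      | inl q =>
        -- a first query `q`: factor through the coins of its signature (exact length)
        set cS := S.sign.coinLen (pairCode (ks.2, q)).length with hcS
        have hfc : S.firstCoinLen 𝒜 ks.2 xr = cS := by rw [SignatureScheme.firstCoinLen, hs]
        have hP : (PMF.uniformOfFintype (List.Vector Bool cS)).map
            (fun v => S.sign.run (ks.2, q) (v.toList.take cS)) = S.sigPMF ks.2 q := by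
          rw [SignatureScheme.sigPMF, RandAlg.outputPMF]
          congr 1
          funext v
          rw [List.take_of_length_le (by rw [v.toList_length])]
        rw [OracleAlg.toOuterMeasure_probTranscript_of_le_one 𝒜.alg _ xr k {t | (ks.1, t) ∈ E}
          (fun t ht => hE _ ht) hs (PMF.uniformOfFintype (List.Vector Bool cS))
          (fun v => S.sign.run (ks.2, q) (v.toList.take cS)) (fun v => S.sigOracleWith ks.2 v.toList) (fun v => rfl) hP]
        rw [toReal_toOuterMeasure_map_uniform_vector
          (fun ρ => (𝒜.alg.queries (S.sigOracleWith ks.2 ρ) (k + 1) xr, 𝒜.alg.run (S.sigOracleWith ks.2 ρ) (k + 1) xr)), hfc]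
        rfl
  -- Step B: average over the key-generation coins and the forger's coins
  set G : List Bool × List Bool → PMF (List Bool × List (List Bool) × Option (List Bool × List Bool)) :=
    fun ks => (𝒜.probTranscriptPMF (fun m => S.sigPMF ks.2 m) (boolPair (unaryEncodeNat n) ks.1)).map
      fun t => (ks.1, t) with hG
  have hexp : S.cmaExpPMF 𝒜 n = (PMF.uniformOfFintype (List.Vector Bool L)).bind (G ∘ fun v => S.keyGen.run n v.toList) := by
    rw [SignatureScheme.cmaExpPMF, SignatureScheme.keyPMF, RandAlg.outputPMF, PMF.bind_map]
  have hGE : ∀ ks : List Bool × List Bool, ((G ks).toOuterMeasure E).toReal =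
      uniformAvg (Cn ks.1) fun r => uniformAvg (S.firstCoinLen 𝒜 ks.2 (boolPair (boolPair (unaryEncodeNat n) ks.1) r)) fun ρ =>
        if (ks.1, 𝒜.alg.queries (S.sigOracleWith ks.2 ρ) (T ks.1) (boolPair (boolPair (unaryEncodeNat n) ks.1) r),
          𝒜.alg.run (S.sigOracleWith ks.2 ρ) (T ks.1) (boolPair (boolPair (unaryEncodeNat n) ks.1) r)) ∈ E then 1 else 0 := by
    intro ks
    rw [hG]
    simp only
    rw [PMF.toOuterMeasure_map_apply, OracleAdversary.probTranscriptPMF, PMF.toOuterMeasure_bind_apply, tsum_fintype,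
      ENNReal.toReal_sum (fun v _ => ?_), SigOWF.uniformAvg_eq_sum_div]
    · refine Finset.sum_congr rfl fun v _ => ?_
      rw [ENNReal.toReal_mul, PMF.uniformOfFintype_apply, card_vector, Fintype.card_bool, ENNReal.toReal_inv]
      simp only [ENNReal.toReal_pow, ENNReal.toReal_ofNat, Nat.cast_pow, Nat.cast_ofNat]
      rw [show (fun t : List (List Bool) × Option (List Bool × List Bool) => (ks.1, t)) ⁻¹' E = {t | (ks.1, t) ∈ E} from rfl,
        hA ks, div_eq_inv_mul]
    · refine ENNReal.mul_ne_top ?_ ?_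
      · rw [PMF.uniformOfFintype_apply]
        exact ENNReal.inv_ne_top.2 (by exact_mod_cast Fintype.card_ne_zero)
      · exact ne_top_of_le_ne_top ENNReal.one_ne_top (pmf_toOuterMeasure_apply_le_one _ _)
  rw [hexp, PMF.toOuterMeasure_bind_apply, tsum_fintype, ENNReal.toReal_sum (fun v _ => ?_), SigOWF.uniformAvg_eq_sum_div]
  · refine Finset.sum_congr rfl fun v _ => ?_
    rw [ENNReal.toReal_mul, Function.comp_apply, hGE, PMF.uniformOfFintype_apply, card_vector, Fintype.card_bool,
      ENNReal.toReal_inv]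
    simp only [ENNReal.toReal_pow, ENNReal.toReal_ofNat, Nat.cast_pow, Nat.cast_ofNat]
    rw [div_eq_inv_mul]
  · refine ENNReal.mul_ne_top ?_ ?_
    · rw [PMF.uniformOfFintype_apply]
      exact ENNReal.inv_ne_top.2 (by exact_mod_cast Fintype.card_ne_zero)
    · exact ne_top_of_le_ne_top ENNReal.one_ne_top (pmf_toOuterMeasure_apply_le_one _ _)


end SignatureScheme

end Literature.Computability.Cryptography

/-! ## Probability bookkeeping: invariances and the small average lemmas -/

namespace Literature.Computability.Cryptography

open Filter Asymptotics _root_.Computability Complexity Finset Polynomial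
open Complexity.Brick

namespace HashSign

namespace Pr

/-- The uniform average over the empty coin space is the value at `ε`. [folklore] -/
theorem uniformAvg_zero (g : List Bool → ℝ) : uniformAvg 0 g = g [] := by
  unfold uniformAvg
  rw [pow_zero, div_one]
  have : (Finset.univ : Finset (List.Vector Bool 0)) = {List.Vector.nil} := by
    ext v; simp [Subsingleton.elim v List.Vector.nil]
  rw [this, Finset.sum_singleton]
  rfl

/-- Additivity of uniform averages. [folklore] -/
theorem uniformAvg_add_distrib (k : ℕ) (f g : List Bool → ℝ) :
    uniformAvg k (fun x => f x + g x) = uniformAvg k f + uniformAvg k g := by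
  unfold uniformAvg
  rw [Finset.sum_add_distrib, add_div]

/-- Splitting off a prefix of the coins, for an arbitrary integrand. [folklore] -/
theorem uniformAvg_split (a b : ℕ) (F : List Bool → ℝ) :
    uniformAvg (a + b) F = uniformAvg a fun u => uniformAvg b fun w => F (u ++ w) := by
  have h := SigOWF.uniformAvg_add' a b (fun u w => F (u ++ w))
  simp only [List.take_append_drop] at h
  exact h

/-- An indicator dominated by the sum of two indicators. [folklore] -/
theorem ite_le_add {P Q R : Prop} [Decidable P] [Decidable Q] [Decidable R] (h : P → Q ∨ R) :
    (if P then (1 : ℝ) else 0) ≤ (if Q then (1 : ℝ) else 0) + (if R then (1 : ℝ) else 0) := by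
  by_cases hp : P
  · rcases h hp with hq | hr
    · rw [if_pos hp, if_pos hq]; split_ifs <;> norm_num
    · rw [if_pos hp, if_pos hr]; split_ifs <;> norm_num
  · rw [if_neg hp]; split_ifs <;> norm_num

/-- A uniform average of a function constant on `k`-bit strings. [folklore] -/
theorem uniformAvg_eq_of_const {k : ℕ} {f : List Bool → ℝ} {c : ℝ} (h : ∀ x : List Bool, x.length = k → f x = c) :
    uniformAvg k f = c := by
  rw [SigOWF.uniformAvg_congr' (g := fun _ => c) h, SigOWF.uniformAvg_const']

/-- Lower-bounding a uniform average by a constant. [folklore] -/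
theorem le_uniformAvg_of_forall {k : ℕ} {f : List Bool → ℝ} {c : ℝ} (h : ∀ x : List Bool, x.length = k → c ≤ f x) :
    c ≤ uniformAvg k f := by
  rw [← SigOWF.uniformAvg_const' k c]
  exact SigOWF.uniformAvg_mono h

end Pr

/-! ### Suffix invariances of the two per-coins attacks -/

variable {H : HashCollection} {S : SignatureScheme} {pI pS pK q : Polynomial ℕ} {CL : ℕ → ℕ}
  {A' : OracleAdversary (List Bool × List Bool)}

namespace Atk

/-- Runs against oracles agreeing on the single query asked agree. [cite: AroraBarak2009, §3.4] -/
theorem run_queries_eq_of_singleton {β : Type} (M : OracleAlg β) {O O' : Oracle} {x : List Bool} {k : ℕ} {qy : List Bool}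
    (hqs : M.queries O k x = [qy]) (hO : O' qy = O qy) : M.run O' k x = M.run O k x ∧ M.queries O' k x = [qy] := by
  have h := FA.runAux_queriesAux_congr M x k [] (O := O) (O' := O') fun y hy => by
    rw [show M.queriesAux O x k [] = M.queries O k x from rfl, hqs, List.mem_singleton] at hy
    rw [hy, hO]
  exact ⟨h.1, h.2.trans hqs⟩

/-- **Case 2 only reads the signing coins of the query's signature**: it is unchanged when the signing coins
are cut to `p_I(n) + p_S(|⟨sk, m₁⟩|)` (the first step being the query `α₁`). [folklore] -/
theorem case2_iff_take (hCL' : ∀ (sk' α ρ : List Bool), pI.eval (fstF sk').length +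
      pS.eval (pairCode (sndF sk', hashedMsg H (beta1 H pI sk' ρ) α)).length ≤ CL (pairCode (sk', α)).length)
    {n : ℕ} {r₀ rA ρ : List Bool} {α₁ : List Bool} (hstep : A'.alg.step (boolPair (xA' S n r₀) rA) [] = Sum.inl α₁) (M : ℕ)
    (hM : pI.eval n + pS.eval (pairCode (sk S n r₀, m1 H pI n ρ α₁)).length ≤ M) :
    Case2 H S pI pS CL A' n r₀ rA ρ ↔ Case2 H S pI pS CL A' n r₀ rA (ρ.take M) := by
  have hb1 : b1 H pI n (ρ.take M) = b1 H pI n ρ := by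
    rw [b1, b1, List.take_take, min_eq_left (by omega)]
  have hm1 : ∀ α, m1 H pI n (ρ.take M) α = m1 H pI n ρ α := fun α => by rw [m1, m1, hb1]
  have hO : O' H S pI pS CL n r₀ (ρ.take M) α₁ = O' H S pI pS CL n r₀ ρ α₁ := by
    rw [FA.O'_apply hCL', FA.O'_apply hCL', hb1, hm1, List.drop_take, List.take_take, min_eq_left (by omega)]
  -- the first query, if asked within the fuel, is `α₁` under either oracle
  have hfirst : ∀ ρ' qy, qs H S pI pS CL A' n r₀ rA ρ' = [qy] → qy = α₁ := by
    intro ρ' qy h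
    rcases hT : T' S A' n r₀ with _ | k
    · rw [qs, hT] at h; simp [OracleAlg.queries, OracleAlg.queriesAux] at h
    · rw [qs, hT, OracleAlg.queries, OracleAlg.queriesAux, hstep] at h
      simp only [List.cons.injEq] at h; exact h.1.symm
  constructor
  · rintro ⟨α₁', α', σ', hqs, hout, hne, hfst, hcoll⟩
    have hα : α₁' = α₁ := hfirst ρ α₁' hqs
    subst hα
    obtain ⟨hrun', hqs'⟩ := run_queries_eq_of_singleton A'.alg hqs hO
    refine ⟨α₁', α', σ', hqs', ?_, hne, by rw [hb1]; exact hfst, by rw [hb1]; exact hcoll⟩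
    rw [out, hrun']; exact hout
  · rintro ⟨α₁', α', σ', hqs, hout, hne, hfst, hcoll⟩
    have hα : α₁' = α₁ := hfirst _ α₁' hqs
    subst hα
    obtain ⟨hrun', hqs'⟩ := run_queries_eq_of_singleton A'.alg hqs hO.symm
    refine ⟨α₁', α', σ', hqs', ?_, hne, by rw [← hb1]; exact hfst, by rw [← hb1]; exact hcoll⟩
    rw [out, hrun']; exact hout

/-- The coin budget at the tagged key, folded. [folklore] -/
theorem budget (hCL' : ∀ (sk' α ρ : List Bool), pI.eval (fstF sk').length +
      pS.eval (pairCode (sndF sk', hashedMsg H (beta1 H pI sk' ρ) α)).length ≤ CL (pairCode (sk', α)).length)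
    (n : ℕ) (r₀ ρ α₁ : List Bool) :
    pI.eval n + pS.eval (pairCode (sk S n r₀, m1 H pI n ρ α₁)).length ≤ CL (pairCode (sk' S n r₀, α₁)).length := by
  have := hCL' (sk' S n r₀) α₁ ρ
  rw [FA.beta1_sk'_eq] at this
  simpa [sk', m1, b1] using this

/-- Case 2 forces a first query. [folklore] -/
theorem step_of_case2 {n : ℕ} {r₀ rA ρ : List Bool} (h : Case2 H S pI pS CL A' n r₀ rA ρ) :
    ∃ α₁, A'.alg.step (boolPair (xA' S n r₀) rA) [] = Sum.inl α₁ ∧ qs H S pI pS CL A' n r₀ rA ρ = [α₁] := by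
  obtain ⟨α₁, α', σ', hqs, -, -, -, -⟩ := h
  refine ⟨α₁, ?_, hqs⟩
  rcases hT : T' S A' n r₀ with _ | k
  · rw [qs, hT] at hqs; simp [OracleAlg.queries, OracleAlg.queriesAux] at hqs
  · rw [qs, hT, OracleAlg.queries, OracleAlg.queriesAux] at hqs
    cases hs : A'.alg.step (boolPair (xA' S n r₀) rA) [] with
    | inr b => rw [hs] at hqs; simp at hqs
    | inl qy => rw [hs] at hqs; simp only [List.cons.injEq] at hqs; rw [hqs.1]

end Atk

namespace FA

/-- The forgery event of `A` against `S` per coins: key coins `r₀`, `A`'s machine input `xw`, `S`'s signing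
coins `ρS`. [Goldreich 2004, Def. 6.4.3] [cite: Goldreich2004, Def. 6.4.3] -/
def ForgeA (H : HashCollection) (S : SignatureScheme) (pI : Polynomial ℕ) (A' : OracleAdversary (List Bool × List Bool))
    (c R : Polynomial ℕ) (ℓ : ℕ → ℕ) (n : ℕ) (r₀ xw ρS : List Bool) : Prop :=
  (Atk.pk S n r₀, (forger H pI A' c R 0).alg.queries (S.sigOracleWith (Atk.sk S n r₀) ρS) 2 xw,
    (forger H pI A' c R 0).alg.run (S.sigOracleWith (Atk.sk S n r₀) ρS) 2 xw) ∈ S.restrictedOneTimeForgeEvent ℓ n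

/-- **`A`'s forgery event only reads the signing coins of its single answer**: it is unchanged when `S`'s
signing coins are cut to the coin length of `A`'s query. [folklore] -/
theorem forgeA_iff_take {c R : Polynomial ℕ} {ℓ : ℕ → ℕ} {n : ℕ} {r₀ xw ρS : List Bool} (M : ℕ)
    (hM : S.sign.coinLen (pairCode (Atk.sk S n r₀, Q H pI A' xw)).length ≤ M) :
    ForgeA H S pI A' c R ℓ n r₀ xw ρS ↔ ForgeA H S pI A' c R ℓ n r₀ xw (ρS.take M) := by
  unfold ForgeA
  rw [show (forger H pI A' c R 0).alg = OracleAlg.oneQueryPair (D A') (Q H pI A') (Out0 H A' c R) (Out1 H pI A' c R) from rfl]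
  by_cases hD : D A' xw = [true]
  · have hO : S.sigOracleWith (Atk.sk S n r₀) (ρS.take M) (Q H pI A' xw) = S.sigOracleWith (Atk.sk S n r₀) ρS (Q H pI A' xw) := by
      rw [SignatureScheme.sigOracleWith, SignatureScheme.sigOracleWith, List.take_take, min_eq_left hM]
    rw [show (2 : ℕ) = 0 + 2 from rfl, OracleAlg.run_oneQueryPair_pos _ _ _ _ _ hD, OracleAlg.run_oneQueryPair_pos _ _ _ _ _ hD,
      OracleAlg.queries_oneQueryPair_pos _ _ _ _ _ hD, OracleAlg.queries_oneQueryPair_pos _ _ _ _ _ hD, hO]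
  · rw [show (2 : ℕ) = 1 + 1 from rfl, OracleAlg.run_oneQueryPair_neg _ _ _ _ _ hD, OracleAlg.run_oneQueryPair_neg _ _ _ _ _ hD,
      OracleAlg.queries_oneQueryPair_neg _ _ _ _ _ hD, OracleAlg.queries_oneQueryPair_neg _ _ _ _ _ hD]

/-- `A`'s first step, as seen by `firstCoinLen`: when `A'` asks, `A` asks `Q xw`. [folklore] -/
theorem firstCoinLen_forger_pos {c R coins : Polynomial ℕ} {n : ℕ} {r₀ xw : List Bool} (hD : D A' xw = [true]) :
    S.firstCoinLen (forger H pI A' c R coins) (Atk.sk S n r₀) xw = S.sign.coinLen (pairCode (Atk.sk S n r₀, Q H pI A' xw)).length := by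
  rw [SignatureScheme.firstCoinLen, show (forger H pI A' c R coins).alg = OracleAlg.oneQueryPair (D A') (Q H pI A') (Out0 H A' c R) (Out1 H pI A' c R) from rfl]
  simp [OracleAlg.oneQueryPair, OracleAlg.mapOut, OracleAlg.oneQuery, hD]

/-- When `A'` does not ask, `A` does not ask. [folklore] -/
theorem firstCoinLen_forger_neg {c R coins : Polynomial ℕ} {n : ℕ} {r₀ xw : List Bool} (hD : D A' xw ≠ [true]) :
    S.firstCoinLen (forger H pI A' c R coins) (Atk.sk S n r₀) xw = 0 := by
  rw [SignatureScheme.firstCoinLen, show (forger H pI A' c R coins).alg = OracleAlg.oneQueryPair (D A') (Q H pI A') (Out0 H A' c R) (Out1 H pI A' c R) from rfl]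
  simp [OracleAlg.oneQueryPair, OracleAlg.mapOut, OracleAlg.oneQuery, hD]

end FA

end HashSign

end Literature.Computability.Cryptography

/-! ## The forging probability of `S'` is dominated by `A`'s and `B'`'s success probabilities -/

namespace Literature.Computability.Cryptography

open Filter Asymptotics _root_.Computability Complexity Finset Polynomial
open Complexity.Brick
open scoped Classical

namespace HashSign

variable (H : HashCollection) (S : SignatureScheme) (pI pS pK q : Polynomial ℕ) (CL : ℕ → ℕ)
  (A' : OracleAdversary (List Bool × List Bool))

namespace Pr

/-! ### The three quantities -/

/-- The number of key-generation coins at `n`. [folklore] -/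
def kc (n : ℕ) : ℕ := S.keyGen.coinLen (unaryEncodeNat n).length

/-- The signing-coin dimension of the real attack: `S'`'s first-signature coins on `(r₀, r_A)`. [folklore] -/
def K (n : ℕ) (r₀ rA : List Bool) : ℕ :=
  (scheme H S pI pS CL).firstCoinLen A' (Atk.sk' S n r₀) (boolPair (Atk.xA' S n r₀) rA)

/-- `P₁`: the probability of Case 1. [Goldreich 2004, proof of Prop. 6.4.31] [cite: Goldreich2004, Prop. 6.4.31] -/
noncomputable def P1 (n : ℕ) : ℝ :=
  uniformAvg (kc S n) fun r₀ => uniformAvg (Atk.cA S A' n r₀) fun rA => uniformAvg (K H S pI pS CL A' n r₀ rA) fun ρ =>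
    if Atk.Case1 H S pI pS CL A' n r₀ rA ρ then 1 else 0

/-- `P₂`: the probability of Case 2. [Goldreich 2004, proof of Prop. 6.4.31] [cite: Goldreich2004, Prop. 6.4.31] -/
noncomputable def P2 (n : ℕ) : ℝ :=
  uniformAvg (kc S n) fun r₀ => uniformAvg (Atk.cA S A' n r₀) fun rA => uniformAvg (K H S pI pS CL A' n r₀ rA) fun ρ =>
    if Atk.Case2 H S pI pS CL A' n r₀ rA ρ then 1 else 0

/-- `P₁ ≥ 0`. [folklore] -/
theorem P1_nonneg (n : ℕ) : 0 ≤ P1 H S pI pS CL A' n :=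
  uniformAvg_nonneg fun _ => uniformAvg_nonneg fun _ => uniformAvg_nonneg fun _ => by split_ifs <;> norm_num

/-- `P₂ ≥ 0`. [folklore] -/
theorem P2_nonneg (n : ℕ) : 0 ≤ P2 H S pI pS CL A' n :=
  uniformAvg_nonneg fun _ => uniformAvg_nonneg fun _ => uniformAvg_nonneg fun _ => by split_ifs <;> norm_num

/-- **The one-time forging probability of `S'` as a triple average** (exact first-signature coins).
[Goldreich 2004, Def. 6.4.2] [cite: Goldreich2004, Def. 6.4.2] -/
theorem forgeProb_eq (n : ℕ) :
    oneTimeForgeProb (scheme H S pI pS CL) A' n =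
      uniformAvg (kc S n) fun r₀ => uniformAvg (Atk.cA S A' n r₀) fun rA => uniformAvg (K H S pI pS CL A' n r₀ rA) fun ρ =>
        if Atk.Forge H S pI pS CL A' n r₀ rA ρ then 1 else 0 := by
  rw [oneTimeForgeProb, SignatureScheme.cmaExp_toReal_eq_uniformAvg_of_le_one_exact (scheme H S pI pS CL) A' n _ (fun t ht => ht.2)]
  rfl

/-- **`Pr[S'-forgery] ≤ P₁ + P₂`** (every forgery falls under Case 1 or Case 2). [Goldreich 2004, proof of
Prop. 6.4.31] [cite: Goldreich2004, Prop. 6.4.31] -/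
theorem forgeProb_le_P1_add_P2 (n : ℕ) :
    oneTimeForgeProb (scheme H S pI pS CL) A' n ≤ P1 H S pI pS CL A' n + P2 H S pI pS CL A' n := by
  rw [forgeProb_eq, P1, P2, ← uniformAvg_add_distrib]
  refine SigOWF.uniformAvg_mono fun r₀ _ => ?_
  rw [← uniformAvg_add_distrib]
  refine SigOWF.uniformAvg_mono fun rA _ => ?_
  rw [← uniformAvg_add_distrib]
  refine SigOWF.uniformAvg_mono fun ρ _ => ?_
  exact ite_le_add (Atk.forge_cases H S pI pS CL A')

/-! ### `P₁` is at most `A`'s restricted one-time forging probability -/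

section P1

variable {H S pI pS pK q CL A'}
variable {ℓ ℓ' : ℕ → ℕ} (hℓ : ∀ n, ℓ n = 2 * n + 2 + ℓ' n) (hR : H.HasRange ℓ')
  (hpI : ∀ n, H.index.coinLen n = pI.eval n) (hpS : ∀ k, S.sign.coinLen k = pS.eval k)
  (hlen : ∀ n, ∀ s ∈ (H.indexPMF n).support, s.length = n)
  (hCL' : ∀ (sk' α ρ : List Bool), pI.eval (fstF sk').length +
    pS.eval (pairCode (sndF sk', hashedMsg H (beta1 H pI sk' ρ) α)).length ≤ CL (pairCode (sk', α)).length)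
  {c R coinsA : Polynomial ℕ}
  (hR' : ∀ (n : ℕ) (r₀ rA rIc pad : List Bool) (β₂ : List Bool), Atk.T' S A' n r₀ ≤ R.eval (FA.gen S n r₀ rA rIc pad).length ∧
    Atk.T' S A' n r₀ ≤ R.eval (boolPair (FA.gen S n r₀ rA rIc pad) β₂).length)
  (hc : ∀ (n : ℕ) (r₀ rA rIc pad : List Bool) (β₂ : List Bool), ∀ qy, A'.alg.step (boolPair (Atk.xA' S n r₀) rA) [] = Sum.inl qy →
    qy.length ≤ c.eval (FA.gen S n r₀ rA rIc pad).length ∧ qy.length ≤ c.eval (boolPair (FA.gen S n r₀ rA rIc pad) β₂).length)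
  (hCA : ∀ (n : ℕ) (r₀ : List Bool), Atk.cA S A' n r₀ + pI.eval n ≤ coinsA.eval (boolPair (unaryEncodeNat n) (Atk.pk S n r₀)).length)

/-- `A`'s restricted one-time forging probability as a triple average. [Goldreich 2004, Def. 6.4.3]
[cite: Goldreich2004, Def. 6.4.3] -/
theorem forgerProb_eq (n : ℕ) :
    S.restrictedOneTimeForgeProb ℓ (FA.forger H pI A' c R coinsA) n =
      uniformAvg (kc S n) fun r₀ => uniformAvg (coinsA.eval (boolPair (unaryEncodeNat n) (Atk.pk S n r₀)).length) fun rt =>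
        uniformAvg (S.firstCoinLen (FA.forger H pI A' c R coinsA) (Atk.sk S n r₀) (boolPair (boolPair (unaryEncodeNat n) (Atk.pk S n r₀)) rt))
          fun ρS => if FA.ForgeA H S pI A' c R ℓ n r₀ (boolPair (boolPair (unaryEncodeNat n) (Atk.pk S n r₀)) rt) ρS then 1 else 0 := by
  rw [SignatureScheme.restrictedOneTimeForgeProb,
    SignatureScheme.cmaExp_toReal_eq_uniformAvg_of_le_one_exact S _ n _ (fun t ht => ht.1.2)]
  refine SigOWF.uniformAvg_congr' fun r₀ _ => SigOWF.uniformAvg_congr' fun rt _ => SigOWF.uniformAvg_congr' fun ρS _ => ?_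
  have hfuel : (FA.forger H pI A' c R coinsA).fuel.eval (boolPair (unaryEncodeNat n) (S.keyGen.run n r₀).1).length = 2 := by
    show (C 2 : Polynomial ℕ).eval _ = 2; rw [eval_C]
  simp only [hfuel]
  rfl

include hℓ hR hpI hpS hlen hCL' hR' hc hCA in
/-- **`P₁ ≤ Pr[A restricted-forges]`.** [Goldreich 2004, proof of Prop. 6.4.31 ("if Case 1 occurs with probability
at least `ε'(n)/2`, then `A` succeeds in its attack on `(G, S, V)` with probability at least `ε'(n)/2`")]
[cite: Goldreich2004, Prop. 6.4.31] -/
theorem P1_le (n : ℕ) : P1 H S pI pS CL A' n ≤ S.restrictedOneTimeForgeProb ℓ (FA.forger H pI A' c R coinsA) n := by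
  rw [forgerProb_eq, P1]
  refine SigOWF.uniformAvg_mono fun r₀ _ => ?_
  -- split `A`'s coins: `rt = rA ++ (rIc ++ pad)`
  set CA := coinsA.eval (boolPair (unaryEncodeNat n) (Atk.pk S n r₀)).length with hCAdef
  obtain ⟨e, he⟩ : ∃ e, CA = Atk.cA S A' n r₀ + (pI.eval n + e) := ⟨CA - Atk.cA S A' n r₀ - pI.eval n, by have := hCA n r₀; omega⟩
  rw [he, uniformAvg_split, ]
  refine SigOWF.uniformAvg_mono fun rA hrA => ?_
  rw [uniformAvg_split]
  set xA0 := boolPair (unaryEncodeNat n) (Atk.pk S n r₀) with hxA0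
  have hgen : ∀ rIc pad : List Bool, boolPair xA0 (rA ++ (rIc ++ pad)) = FA.gen S n r₀ rA rIc pad := fun rIc pad => by
    rw [FA.gen, List.append_assoc]
  have hpre : ∀ rIc pad : List Bool, FA.preE A' (FA.gen S n r₀ rA rIc pad) = boolPair (Atk.xA' S n r₀) rA := fun rIc pad => FA.preE_gen hrA
  by_cases hask : ∃ α₁, A'.alg.step (boolPair (Atk.xA' S n r₀) rA) [] = Sum.inl α₁
  · -- `A'` asks `α₁`
    obtain ⟨α₁, hstep⟩ := hask
    have hD : ∀ rIc pad : List Bool, FA.D A' (FA.gen S n r₀ rA rIc pad) = [true] := fun rIc pad =>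
      (OracleAlg.asksFirstFn_eq_true_iff _ _ _).2 ⟨α₁, by rw [hpre]; exact hstep⟩
    have hK : K H S pI pS CL A' n r₀ rA = CL (pairCode (Atk.sk' S n r₀, α₁)).length := by
      rw [K, SignatureScheme.firstCoinLen, hstep]; rfl
    obtain ⟨K', hK'⟩ : ∃ K', CL (pairCode (Atk.sk' S n r₀, α₁)).length = pI.eval n + K' :=
      ⟨CL (pairCode (Atk.sk' S n r₀, α₁)).length - pI.eval n, by have := Atk.budget (S := S) hCL' n r₀ [] α₁; omega⟩
    rw [hK, hK', uniformAvg_split]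
    refine SigOWF.uniformAvg_mono fun rIc hrIc => ?_
    -- the value signed by `A` and its coin length, for this `rIc`
    set cS₁ := pS.eval (pairCode (Atk.sk S n r₀, hashedMsg H (H.index.run n rIc) α₁)).length with hcS₁
    have hb1 : ∀ u : List Bool, Atk.b1 H pI n (rIc ++ u) = H.index.run n rIc := fun u => by
      rw [Atk.b1, List.take_left' hrIc]
    have hm1 : ∀ u : List Bool, Atk.m1 H pI n (rIc ++ u) α₁ = hashedMsg H (H.index.run n rIc) α₁ := fun u => by rw [Atk.m1, hb1]
    have hK'ge : cS₁ ≤ K' := by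
      have := Atk.budget (S := S) hCL' n r₀ (rIc ++ []) α₁
      rw [hm1] at this
      omega
    obtain ⟨e', he'⟩ : ∃ e', K' = cS₁ + e' := ⟨K' - cS₁, by omega⟩
    -- the bound, uniformly in the padding
    refine le_uniformAvg_of_forall fun pad _ => ?_
    have hQ : FA.Q H pI A' (FA.gen S n r₀ rA rIc pad) = hashedMsg H (H.index.run n rIc) α₁ := by
      have ha1 : FA.a1E A' (FA.gen S n r₀ rA rIc pad) = α₁ := by
        rw [FA.a1E]
        refine OracleAlg.firstQueryFn_eq (fun _ => []) (n := 1) (qs := []) ?_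
        rw [hpre, OracleAlg.queries, OracleAlg.queriesAux, hstep]
        rfl
      rw [FA.Q, FA.b1E_gen hrA hrIc, ha1]
    have hcS : S.firstCoinLen (FA.forger H pI A' c R coinsA) (Atk.sk S n r₀) (boolPair xA0 (rA ++ (rIc ++ pad))) = cS₁ := by
      rw [hgen, FA.firstCoinLen_forger_pos (hD rIc pad), hQ, hpS]
    rw [hcS]
    -- Case 1 ⇒ `A` forges with signing coins `ρ ⇂ pI = u`; then cut `u` to `cS₁`
    calc uniformAvg K' (fun u => if Atk.Case1 H S pI pS CL A' n r₀ rA (rIc ++ u) then (1 : ℝ) else 0)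
        ≤ uniformAvg K' (fun u => if FA.ForgeA H S pI A' c R ℓ n r₀ (boolPair xA0 (rA ++ (rIc ++ pad))) u then (1 : ℝ) else 0) := by
          refine SigOWF.uniformAvg_mono fun u hu => ?_
          split_ifs with h1 h2
          · exact le_rfl
          · exfalso; apply h2
            have hρ : pI.eval n ≤ (rIc ++ u).length := by rw [List.length_append]; omega
            have h := FA.forgeA_of_case1 (pad := pad) (c := c) (R := R) hℓ hR hpI hpS hlen hCL' hR' hc hrA hρ h1
            rw [List.take_left' hrIc, List.drop_left' hrIc] at h
            rw [FA.ForgeA, hgen]; exact h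
          · norm_num
          · exact le_rfl
      _ = uniformAvg K' (fun u => if FA.ForgeA H S pI A' c R ℓ n r₀ (boolPair xA0 (rA ++ (rIc ++ pad))) (u.take cS₁) then (1 : ℝ) else 0) := by
          refine SigOWF.uniformAvg_congr' fun u _ => ?_
          rw [FA.forgeA_iff_take cS₁ (by rw [hgen, hQ, hpS])]
      _ = uniformAvg cS₁ (fun ρS => if FA.ForgeA H S pI A' c R ℓ n r₀ (boolPair xA0 (rA ++ (rIc ++ pad))) ρS then (1 : ℝ) else 0) := by
          rw [he']
          exact SigOWF.uniformAvg_take' cS₁ e'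
            (fun ρS => if FA.ForgeA H S pI A' c R ℓ n r₀ (boolPair xA0 (rA ++ (rIc ++ pad))) ρS then (1 : ℝ) else 0)
  · -- `A'` asks nothing: the dimension is `0` on both sides and `A` forges for all coins
    have hstep : ∃ b', A'.alg.step (boolPair (Atk.xA' S n r₀) rA) [] = Sum.inr b' := by
      cases hs : A'.alg.step (boolPair (Atk.xA' S n r₀) rA) [] with
      | inl qy => exact absurd ⟨qy, hs⟩ hask
      | inr b' => exact ⟨b', rfl⟩
    obtain ⟨b', hb'⟩ := hstep
    have hK : K H S pI pS CL A' n r₀ rA = 0 := by rw [K, SignatureScheme.firstCoinLen, hb']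
    rw [hK, uniformAvg_zero]
    split_ifs with h1
    · refine le_uniformAvg_of_forall fun rIc _ => le_uniformAvg_of_forall fun pad _ => le_uniformAvg_of_forall fun ρS _ => ?_
      rw [if_pos]
      rw [FA.ForgeA, hgen]
      exact FA.forgeA_of_case1_noquery hℓ hR hR' hrA h1 ⟨b', hb'⟩ rIc pad ρS
    · exact uniformAvg_nonneg fun _ => uniformAvg_nonneg fun _ => uniformAvg_nonneg fun _ => by split_ifs <;> norm_num

end P1

/-! ### `P₂` is at most `B'`'s designated-collision probability -/

section P2

variable {H S pI pS pK q CL A'}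
variable (hpI : ∀ n, H.index.coinLen n = pI.eval n) (hpK : ∀ n, S.keyGen.coinLen n = pK.eval n)
  (hCL' : ∀ (sk' α ρ : List Bool), pI.eval (fstF sk').length +
    pS.eval (pairCode (sndF sk', hashedMsg H (beta1 H pI sk' ρ) α)).length ≤ CL (pairCode (sk', α)).length)
  (hq : StrictMono fun n => q.eval n) (hqn : ∀ n, n ≤ q.eval n)
  {c R : Polynomial ℕ}
  (hR' : ∀ (n : ℕ) (s r : List Bool), r.length = q.eval n → ∀ r₀ : List Bool, r₀.length = pK.eval n →
    Atk.T' S A' n r₀ ≤ R.eval (boolPair (boolPair (unaryEncodeNat n) (boolPair s r)) ([] : List Bool)).length)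
  (hc : ∀ (n : ℕ) (s r : List Bool), r.length = q.eval n → ∀ r₀ : List Bool, r₀.length = pK.eval n →
    ∀ rA : List Bool, rA.length = Atk.cA S A' n r₀ → ∀ qy : List Bool, A'.alg.step (boolPair (Atk.xA' S n r₀) rA) [] = Sum.inl qy →
      qy.length ≤ c.eval (boolPair (boolPair (unaryEncodeNat n) (boolPair s r)) ([] : List Bool)).length)
  (hq1 : ∀ (n : ℕ) (r₀ : List Bool), r₀.length = pK.eval n → ∀ (rA rI α₁ : List Bool), rI.length = pI.eval n →
    pK.eval n + Atk.cA S A' n r₀ + pS.eval (pairCode (Atk.sk S n r₀, hashedMsg H (H.index.run n rI) α₁)).length ≤ q.eval n)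

include hpI hpK hCL' hq hqn hR' hc hq1 in
/-- **`P₂ ≤ Pr[(A₀, B') forms a designated collision]`.** [Goldreich 2004, proof of Prop. 6.4.31 ("if Case 2
occurs with probability at least `ε'(n)/2` … `B'` has succeeded in forming a designated collision with
probability at least …")] [cite: Goldreich2004, Prop. 6.4.31] -/
theorem P2_le (n : ℕ) :
    P2 H S pI pS CL A' n ≤ H.tcrProb (fun n => q.eval n) (FB.A0 S pK q A') (FB.finder H S pS pK q A' c R) n := by
  rw [HashCollection.tcrProb_eq_uniformAvg, P2]
  have hkc : kc S n = pK.eval n := by rw [kc, Complexity.unaryEncodeNat_eq_replicate, List.length_replicate, hpK]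
  have hcI : H.index.coinLen (unaryEncodeNat n).length = pI.eval n := by
    rw [Complexity.unaryEncodeNat_eq_replicate, List.length_replicate, hpI]
  -- `B'` is coinless: the innermost average is an evaluation
  simp only [show ∀ z, (FB.finder H S pS pK q A' c R).coinLen z = 0 from fun _ => rfl, uniformAvg_zero, hcI]
  -- split the target coins: `r = r₀ ++ r1`
  obtain ⟨L1, hL1⟩ : ∃ L1, q.eval n = pK.eval n + L1 := ⟨q.eval n - pK.eval n, by
    have := hq1 n (List.replicate (pK.eval n) false) (by simp) [] (List.replicate (pI.eval n) false) [] (by simp); omega⟩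
  rw [hL1, uniformAvg_split, hkc]
  refine SigOWF.uniformAvg_mono fun r₀ hr₀ => ?_
  -- `r1 = rA ++ rrest`
  obtain ⟨rem, hrem⟩ : ∃ rem, L1 = Atk.cA S A' n r₀ + rem := ⟨L1 - Atk.cA S A' n r₀, by
    have := hq1 n r₀ hr₀ [] (List.replicate (pI.eval n) false) [] (by simp); omega⟩
  rw [hrem, uniformAvg_split]
  refine SigOWF.uniformAvg_mono fun rA hrA => ?_
  by_cases hask : ∃ α₁, A'.alg.step (boolPair (Atk.xA' S n r₀) rA) [] = Sum.inl α₁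
  · obtain ⟨α₁, hstep⟩ := hask
    have hK : K H S pI pS CL A' n r₀ rA = CL (pairCode (Atk.sk' S n r₀, α₁)).length := by
      rw [K, SignatureScheme.firstCoinLen, hstep]; rfl
    obtain ⟨K', hK'⟩ : ∃ K', CL (pairCode (Atk.sk' S n r₀, α₁)).length = pI.eval n + K' :=
      ⟨CL (pairCode (Atk.sk' S n r₀, α₁)).length - pI.eval n, by have := Atk.budget (S := S) hCL' n r₀ [] α₁; omega⟩
    rw [hK, hK', uniformAvg_split, DetSign.uniformAvg_comm rem (pI.eval n)]
    refine SigOWF.uniformAvg_mono fun rI hrI => ?_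
    set cS₁ := pS.eval (pairCode (Atk.sk S n r₀, hashedMsg H (H.index.run n rI) α₁)).length with hcS₁
    have hb1 : ∀ u : List Bool, Atk.b1 H pI n (rI ++ u) = H.index.run n rI := fun u => by rw [Atk.b1, List.take_left' hrI]
    have hm1 : ∀ u : List Bool, Atk.m1 H pI n (rI ++ u) α₁ = hashedMsg H (H.index.run n rI) α₁ := fun u => by rw [Atk.m1, hb1]
    have hK'ge : cS₁ ≤ K' := by
      have := Atk.budget (S := S) hCL' n r₀ (rI ++ []) α₁
      rw [hm1] at this
      omega
    have hremge : cS₁ ≤ rem := by have := hq1 n r₀ hr₀ rA rI α₁ hrI; omega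
    obtain ⟨e', he'⟩ : ∃ e', K' = cS₁ + e' := ⟨K' - cS₁, by omega⟩
    obtain ⟨e'', he''⟩ : ∃ e'', rem = cS₁ + e'' := ⟨rem - cS₁, by omega⟩
    -- LHS: Case 2 reads only `rI ++ u ↾ cS₁`
    have hL : uniformAvg K' (fun u => if Atk.Case2 H S pI pS CL A' n r₀ rA (rI ++ u) then (1 : ℝ) else 0) =
        uniformAvg cS₁ (fun u => if Atk.Case2 H S pI pS CL A' n r₀ rA (rI ++ u) then (1 : ℝ) else 0) := by
      rw [he', ← SigOWF.uniformAvg_take' cS₁ e']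
      have htake : ∀ v : List Bool, (rI ++ v).take (pI.eval n + cS₁) = rI ++ v.take cS₁ := fun v => by
        rw [List.take_append, List.take_of_length_le (by omega), hrI, Nat.add_sub_cancel_left]
      refine SigOWF.uniformAvg_congr' fun u _ => ?_
      have e1 := Atk.case2_iff_take (CL := CL) (A' := A') (rA := rA) hCL' hstep (pI.eval n + cS₁) (by rw [hm1]) (ρ := rI ++ u)
      rw [htake] at e1
      by_cases h1 : Atk.Case2 H S pI pS CL A' n r₀ rA (rI ++ u)
      · rw [if_pos h1, if_pos (e1.mp h1)]
      · rw [if_neg h1, if_neg (fun h => h1 (e1.mpr h))]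
    rw [hL, he'', uniformAvg_split]
    refine SigOWF.uniformAvg_mono fun u hu => le_uniformAvg_of_forall fun pad hpad => ?_
    -- RHS: Case 2 ⇒ designated collision
    split_ifs with h2 hcoll
    · exact le_rfl
    · exfalso; apply hcoll
      have hLtot : (r₀ ++ rA ++ ((rI ++ u).drop (pI.eval n) ++ pad)).length = q.eval n := by
        rw [List.drop_left' hrI]; simp only [List.length_append]; omega
      have hρ : ∀ α₁', A'.alg.step (boolPair (Atk.xA' S n r₀) rA) [] = Sum.inl α₁' →
          pI.eval n + pS.eval (pairCode (Atk.sk S n r₀, Atk.m1 H pI n (rI ++ u) α₁')).length ≤ (rI ++ u).length := by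
        intro α₁' h'
        rw [hstep, Sum.inl.injEq] at h'
        subst h'
        rw [hm1, List.length_append, hrI, hu]
      have hcol := FB.collision_of_case2 (pK := pK) (q := q) (c := c) (R := R) (rest := pad) hCL' hq hqn hR' hc hr₀ hrA hLtot hρ h2
      rw [hb1, List.drop_left' hrI] at hcol
      rw [show r₀ ++ (rA ++ (u ++ pad)) = r₀ ++ rA ++ (u ++ pad) by simp only [List.append_assoc]]
      exact hcol
    · norm_num
    · exact le_rfl
  · -- no query: Case 2 is impossible
    have h0 : ∀ ρ, ¬ Atk.Case2 H S pI pS CL A' n r₀ rA ρ := fun ρ h => by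
      obtain ⟨α₁, hstep, -⟩ := Atk.step_of_case2 h
      exact hask ⟨α₁, hstep⟩
    simp only [h0, if_false]
    rw [SigOWF.uniformAvg_const']
    exact uniformAvg_nonneg fun _ => uniformAvg_nonneg fun _ => by split_ifs <;> norm_num

end P2

end Pr

end HashSign

end Literature.Computability.Cryptography

/-! ## Prop. 6.4.31 (furthermore-part): assembling the budgets and the negligible bound -/

namespace Literature.Computability.Cryptography

open Filter Asymptotics _root_.Computability Complexity Finset Polynomial
open Complexity.Brick Complexity.Plumb Complexity.OracleCompose

namespace HashSign

variable (H : HashCollection) (S : SignatureScheme) (pI pS pK : Polynomial ℕ) (A' : OracleAdversary (List Bool × List Bool))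

namespace Bud

/-! ### Output-length polynomials of the ingredients -/

/-- Length of a pair code. [folklore] -/
theorem length_pairCode (a b : List Bool) : (pairCode (a, b)).length = 2 * a.length + 2 + b.length := by
  show (boolPair a b).length = _; rw [length_boolPair]

/-- `|fstF w| ≤ |w|` and `|sndF w| ≤ |w|`. [folklore] -/
theorem length_fstF_sndF_le (w : List Bool) : (fstF w).length ≤ w.length ∧ (sndF w).length ≤ w.length := by
  have h := length_boolUnpair_parts_le w
  exact ⟨by unfold fstF; omega, by unfold sndF; omega⟩

variable {H S}

/-- A bound on the keys: `|pk|, |sk| ≤ oK(2n + 2 + |r₀|)`. [folklore] -/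
theorem key_length_le {oK : Polynomial ℕ} (hoK : ∀ x, (SigOWF.kgFn (ctx S) x).length ≤ oK.eval x.length) (n : ℕ) (r₀ : List Bool) :
    (Atk.pk S n r₀).length ≤ oK.eval (2 * n + 2 + r₀.length) ∧ (Atk.sk S n r₀).length ≤ oK.eval (2 * n + 2 + r₀.length) := by
  have h := hoK (boolPair (unaryEncodeNat n) r₀)
  rw [SigOWF.kgFn_boolPair, length_boolPair, Complexity.unaryEncodeNat_eq_replicate, List.length_replicate] at h
  have h1 := length_fstF_sndF_le (pairCode ((ctx S).S.keyGen.run n r₀))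
  rw [FB.fstF_pairCode, FB.sndF_pairCode] at h1
  exact ⟨h1.1.trans h, h1.2.trans h⟩

/-- A bound on hash indices: `|I(1ᵐ; r)| ≤ oI(2m + 2 + |r|)`. [folklore] -/
theorem index_length_le {oI : Polynomial ℕ} (hoI : ∀ x, (iFn H x).length ≤ oI.eval x.length) (m : ℕ) (r : List Bool) :
    (H.index.run m r).length ≤ oI.eval (2 * m + 2 + r.length) := by
  have h := hoI (boolPair (ones m) r)
  simp only [iFn, fstF_boolPair, sndF_boolPair, List.length_replicate, length_boolPair] at h
  exact h

/-- A bound on hash values: `|h_s(x)| ≤ ph(2|s| + 2 + |x|)`. [folklore] -/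
theorem hash_length_le {ph : Polynomial ℕ} (hph : ∀ x, (hFn H x).length ≤ ph.eval x.length) (s x : List Bool) :
    (H.hash s x).length ≤ ph.eval (2 * s.length + 2 + x.length) := by
  have h := hph (boolPair s x)
  simp only [hFn, fstF_boolPair, sndF_boolPair, length_boolPair] at h
  exact h

/-! ### The signing-coin budget `CP` of `S'` -/

/-- The coin budget of `S'`: `p_I(N) + p_S(2N + 4 + 2·BI(N) + ph(2·BI(N) + 2 + N))` with `BI = oI(2N + 2 + p_I(N))`.
[folklore] -/
noncomputable def CP (oI ph : Polynomial ℕ) : Polynomial ℕ :=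
  pI + pS.comp (C 2 * X + C 4 + C 2 * oI.comp (C 2 * X + C 2 + pI) + ph.comp (C 2 * oI.comp (C 2 * X + C 2 + pI) + C 2 + X))

/-- **The budget inequality `hCL'`** for `CL = CP`. [folklore] -/
theorem hCL'_CP {oI ph : Polynomial ℕ} (hoI : ∀ x, (iFn H x).length ≤ oI.eval x.length) (hph : ∀ x, (hFn H x).length ≤ ph.eval x.length)
    (sk' α ρ : List Bool) :
    pI.eval (fstF sk').length + pS.eval (pairCode (sndF sk', hashedMsg H (beta1 H pI sk' ρ) α)).length ≤
      (CP pI pS oI ph).eval (pairCode (sk', α)).length := by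
  set N := (pairCode (sk', α)).length with hN
  have hNdef : N = 2 * sk'.length + 2 + α.length := length_pairCode _ _
  have hfs := length_fstF_sndF_le sk'
  have hm : (fstF sk').length ≤ N := by omega
  have hβ : (beta1 H pI sk' ρ).length ≤ oI.eval (2 * N + 2 + pI.eval N) := by
    refine (index_length_le hoI _ _).trans (natPoly_eval_mono _ ?_)
    have : (ρ.take (pI.eval (fstF sk').length)).length ≤ pI.eval N := by
      rw [List.length_take]; exact (min_le_left _ _).trans (natPoly_eval_mono _ hm)
    omega
  have hh : (H.hash (beta1 H pI sk' ρ) α).length ≤ ph.eval (2 * oI.eval (2 * N + 2 + pI.eval N) + 2 + N) :=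
    (hash_length_le hph _ _).trans (natPoly_eval_mono _ (by omega))
  have hmsg : (pairCode (sndF sk', hashedMsg H (beta1 H pI sk' ρ) α)).length ≤
      2 * N + 4 + 2 * oI.eval (2 * N + 2 + pI.eval N) + ph.eval (2 * oI.eval (2 * N + 2 + pI.eval N) + 2 + N) := by
    rw [length_pairCode, hashedMsg, length_boolPair]; omega
  have h1 : pI.eval (fstF sk').length ≤ pI.eval N := natPoly_eval_mono _ hm
  have h2 := natPoly_eval_mono pS hmsg
  simp only [CP, eval_add, eval_comp, eval_mul, eval_C, eval_X]
  omega

/-! ### The budgets of the reductions -/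

/-- The emulation cap: `c = R_{A'}(4N)`. [folklore] -/
noncomputable def cPoly (RA : Polynomial ℕ) : Polynomial ℕ := RA.comp (C 4 * X)

/-- `A`'s coin budget: `c_{A'}(2N) + p_I(N)`. [folklore] -/
noncomputable def coinsA : Polynomial ℕ := A'.coins.comp (C 2 * X) + pI

/-- A bound on `|x_{A'}| = 4n + 4 + |pk|` for `|r₀| = p_K(n)`. [folklore] -/
noncomputable def XP (oK : Polynomial ℕ) : Polynomial ℕ := C 4 * X + C 4 + oK.comp (C 2 * X + C 2 + pK)

/-- A bound on `|⟨sk, ⟨s, h_s(α₁)⟩⟩|`. [folklore] -/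
noncomputable def MP (oK ph : Polynomial ℕ) : Polynomial ℕ := C 2 * oK.comp (C 2 * X + C 2 + pK) + C 2 * X + C 4 + ph.comp (C 2 * X + C 2)

/-- The length of the target coins: `q = p_K + c_{A'}(XP) + p_S(MP) + 4·XP + X + 8`. [folklore] -/
noncomputable def qPoly (oK ph : Polynomial ℕ) : Polynomial ℕ :=
  pK + A'.coins.comp (XP pK oK) + pS.comp (MP pK oK ph) + C 4 * XP pK oK + X + C 8

/-- `q` is strictly increasing. [folklore] -/
theorem qPoly_strictMono (oK ph : Polynomial ℕ) : StrictMono fun n => (qPoly pS pK A' oK ph).eval n := by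
  intro a b hab
  have h1 := natPoly_eval_mono (pK + A'.coins.comp (XP pK oK) + pS.comp (MP pK oK ph) + C 4 * XP pK oK) hab.le
  simp only [qPoly, eval_add, eval_X, eval_C] at h1 ⊢
  omega

/-- `n ≤ q(n)`. [folklore] -/
theorem le_qPoly (oK ph : Polynomial ℕ) (n : ℕ) : n ≤ (qPoly pS pK A' oK ph).eval n := by
  simp only [qPoly, eval_add, eval_X, eval_C]; omega

/-- `|x_{A'}| ≤ XP(n)` when `|r₀| = p_K(n)`. [folklore] -/
theorem length_xA'_le {oK : Polynomial ℕ} (hoK : ∀ x, (SigOWF.kgFn (ctx S) x).length ≤ oK.eval x.length) {n : ℕ} {r₀ : List Bool}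
    (hr₀ : r₀.length = pK.eval n) : (Atk.xA' S n r₀).length ≤ (XP pK oK).eval n := by
  have hk := (key_length_le hoK n r₀).1
  rw [hr₀] at hk
  simp only [Atk.xA', Atk.pk', length_boolPair, Complexity.unaryEncodeNat_eq_replicate, List.length_replicate, XP, eval_add, eval_mul,
    eval_C, eval_X, eval_comp, ones]
  omega

/-- The length of `A`'s genuine machine input dominates `|x_{A'}| + |r_A| + 2`. [folklore] -/
theorem length_gen_ge (n : ℕ) (r₀ rA rIc pad : List Bool) : (Atk.xA' S n r₀).length + rA.length + 2 ≤ (FA.gen S n r₀ rA rIc pad).length := by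
  simp only [FA.gen, Atk.xA', Atk.pk', length_boolPair, List.length_append, Complexity.unaryEncodeNat_eq_replicate, List.length_replicate, ones]
  omega

/-- The first query of `A'` is short: `|q| + 1 ≤ R_{A'}(4|x| + 2|r| + 8)`. [folklore] -/
theorem firstQuery_length_le {RA : Polynomial ℕ}
    (hRA : ∀ (x : List Bool) (as : List (List Bool)), (((encodingList Bool).sumBool ((encodingList Bool).pairBool (encodingList Bool))).encode
      (A'.alg.step x as)).length ≤ RA.eval (boolPair x ((encodingList Bool).listBool.encode as)).length)
    {x r qy : List Bool} (h : A'.alg.step (boolPair x r) [] = Sum.inl qy) : qy.length + 1 ≤ RA.eval (4 * x.length + 2 * r.length + 8) := by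
  have h1 := hRA (boolPair x r) []
  rw [h] at h1
  have hlen : (boolPair (boolPair x r) ((encodingList Bool).listBool.encode ([] : List (List Bool)))).length = 4 * x.length + 2 * r.length + 8 := by
    show (boolPair (boolPair x r) [false, true]).length = _
    simp only [length_boolPair, List.length_cons, List.length_nil]; omega
  rw [hlen] at h1
  have h2 : (((encodingList Bool).sumBool ((encodingList Bool).pairBool (encodingList Bool))).encode (Sum.inl qy)).length = qy.length + 1 := by
    show (false :: qy).length = _
    rw [List.length_cons]
  omega

end Bud

/-! ### The main theorem -/

section Main

variable {H S pI pS pK}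
variable {ℓ ℓ' : ℕ → ℕ} (hℓ : ∀ n, ℓ n = 2 * n + 2 + ℓ' n)
  (hpI : ∀ n, H.index.coinLen n = pI.eval n) (hpS : ∀ k, S.sign.coinLen k = pS.eval k) (hpK : ∀ n, S.keyGen.coinLen n = pK.eval n)
  (hlen : ∀ n, ∀ s ∈ (H.indexPMF n).support, s.length = n)

include hℓ hpI hpS hpK hlen in
/-- **Proposition 6.4.31, furthermore-part (one-time hash-and-sign with a UOWHF).** If `(G, S, V)` is a secure
`ℓ`-restricted ONE-TIME signature scheme and `{h_s}` is a universal one-way hash family with range specifier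
`ℓ'` (`ℓ(n) = 2n + 2 + ℓ'(n)` in the pair code), indices of length `n` and explicit polynomial coin
budgets, then Construction 6.4.30 — with a suitable polynomial signing-coin budget — is a secure (full-fledged)
one-time signature scheme. The proof is the printed one: a one-time forger `A'` either forges on a fresh
hashed value (Case 1: the one-query forger `FA.forger` breaks `(G, S, V)`, `Pr.P1_le`) or re-uses the hashed
value of its single query under the index chosen after the query (Case 2: `(FB.A0, FB.finder)` forms a
designated collision, `Pr.P2_le`); both probabilities are negligible. [Goldreich 2004, Prop. 6.4.31 and
Construction 6.4.30] [cite: Goldreich2004, Prop. 6.4.31] -/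
theorem isOneTimeSecure (hH : H.IsUOWHF ℓ') (hS : S.IsRestrictedOneTimeSecure ℓ) :
    ∃ CL : ℕ → ℕ, (scheme H S pI pS CL).IsOneTimeSecure := by
  classical
  -- output-length polynomials of `I`, `h`, `G`
  obtain ⟨oI, hoI⟩ := exists_poly_length_le_of_mem_FP (iFn_mem_FP hH.1.1)
  obtain ⟨ph, hph⟩ := exists_poly_length_le_of_mem_FP (hFn_mem_FP hH.1.2)
  obtain ⟨oK, hoK⟩ := exists_poly_length_le_of_mem_FP (SigOWF.kgFn_mem_FP (P := ctx S) hS.1.1.1)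
  refine ⟨fun N => (Bud.CP pI pS oI ph).eval N, ?_, ?_, fun A' hA' => ?_⟩
  · exact isEfficient H S pI pS hS.1 hH.1 (Bud.CP pI pS oI ph) fun _ => le_rfl
  · refine isCorrect H S hℓ hH.2.1 hpI hpS hlen hS.2.1 fun n sk α ρ => ?_
    have h := Bud.hCL'_CP (H := H) pI pS hoI hph (boolPair (ones n) sk) α ρ
    simp only [fstF_boolPair, sndF_boolPair, List.length_replicate, ones] at h ⊢
    simp only [beta1, fstF_boolPair, List.length_replicate] at h ⊢
    exact h
  -- the reductions and their budgets
  have hCL' := Bud.hCL'_CP (H := H) pI pS hoI hph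
  obtain ⟨RA, hRA⟩ := OracleAlg.IsPolyTime.exists_length_le hA'
  set c := Bud.cPoly RA with hc
  set R := A'.fuel with hR
  set cA := Bud.coinsA pI A' with hcA
  set q := Bud.qPoly pS pK A' oK ph with hq
  set A := FA.forger H pI A' c R cA with hAdef
  set B' := FB.finder H S pS pK q A' c R with hB'
  have hAppt : A.IsPPT ((encodingList Bool).pairBool (encodingList Bool)) := FA.forger_isPPT H pI A' hA' hH.1.1 hH.1.2 c R cA
  have hA0 : FB.A0 S pK q A' ∈ FP := FB.A0_mem_FP S pK q A' hA' hS.1.1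
  have hB'ppt : IsPPT B' id := FB.finder_isPPT H S pS pK q A' hA' hS.1.1 hS.1.2.1 hH.1.2 c R
  have hnegA : SuperpolynomialDecay atTop (fun n : ℕ => (n : ℝ)) (S.restrictedOneTimeForgeProb ℓ A) := hS.2.2 A hAppt
  have hnegB : SuperpolynomialDecay atTop (fun n : ℕ => (n : ℝ)) (H.tcrProb (fun n => q.eval n) (FB.A0 S pK q A') B') :=
    hH.2.2.2 q _ hA0 B' hB'ppt
  -- budget facts
  have hR'A : ∀ (n : ℕ) (r₀ rA rIc pad β₂ : List Bool), Atk.T' S A' n r₀ ≤ R.eval (FA.gen S n r₀ rA rIc pad).length ∧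
      Atk.T' S A' n r₀ ≤ R.eval (boolPair (FA.gen S n r₀ rA rIc pad) β₂).length := fun n r₀ rA rIc pad β₂ => by
    have h1 := Bud.length_gen_ge (S := S) n r₀ rA rIc pad
    have h2 : (FA.gen S n r₀ rA rIc pad).length ≤ (boolPair (FA.gen S n r₀ rA rIc pad) β₂).length := by rw [length_boolPair]; omega
    exact ⟨natPoly_eval_mono _ (by omega), natPoly_eval_mono _ (by omega)⟩
  have hcA' : ∀ (n : ℕ) (r₀ rA rIc pad β₂ qy : List Bool), A'.alg.step (boolPair (Atk.xA' S n r₀) rA) [] = Sum.inl qy →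
      qy.length ≤ c.eval (FA.gen S n r₀ rA rIc pad).length ∧ qy.length ≤ c.eval (boolPair (FA.gen S n r₀ rA rIc pad) β₂).length := by
    intro n r₀ rA rIc pad β₂ qy h
    have h1 := Bud.firstQuery_length_le A' hRA h
    have h2 := Bud.length_gen_ge (S := S) n r₀ rA rIc pad
    have h3 : (FA.gen S n r₀ rA rIc pad).length ≤ (boolPair (FA.gen S n r₀ rA rIc pad) β₂).length := by rw [length_boolPair]; omega
    simp only [hc, Bud.cPoly, eval_comp, eval_mul, eval_C, eval_X]
    exact ⟨by have := natPoly_eval_mono RA (show 4 * (Atk.xA' S n r₀).length + 2 * rA.length + 8 ≤ 4 * (FA.gen S n r₀ rA rIc pad).length by omega); omega,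
      by have := natPoly_eval_mono RA (show 4 * (Atk.xA' S n r₀).length + 2 * rA.length + 8 ≤ 4 * (boolPair (FA.gen S n r₀ rA rIc pad) β₂).length by omega); omega⟩
  have hCAb : ∀ (n : ℕ) (r₀ : List Bool), Atk.cA S A' n r₀ + pI.eval n ≤ cA.eval (boolPair (unaryEncodeNat n) (Atk.pk S n r₀)).length := by
    intro n r₀
    have hx : (Atk.xA' S n r₀).length ≤ 2 * (boolPair (unaryEncodeNat n) (Atk.pk S n r₀)).length := by
      simp only [Atk.xA', Atk.pk', length_boolPair, Complexity.unaryEncodeNat_eq_replicate, List.length_replicate, ones]; omega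
    have hn : n ≤ (boolPair (unaryEncodeNat n) (Atk.pk S n r₀)).length := by
      simp only [length_boolPair, Complexity.unaryEncodeNat_eq_replicate, List.length_replicate]; omega
    simp only [hcA, Bud.coinsA, eval_add, eval_comp, eval_mul, eval_C, eval_X, Atk.cA]
    have := natPoly_eval_mono A'.coins hx
    have := natPoly_eval_mono pI hn
    omega
  have hXP : ∀ (n : ℕ) (r₀ : List Bool), r₀.length = pK.eval n → (Atk.xA' S n r₀).length ≤ (Bud.XP pK oK).eval n := fun n r₀ hr₀ =>
    Bud.length_xA'_le (S := S) pK hoK hr₀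
  have hzlen : ∀ (n : ℕ) (s r : List Bool), 2 * r.length ≤ (boolPair (boolPair (unaryEncodeNat n) (boolPair s r)) ([] : List Bool)).length := by
    intro n s r; simp only [length_boolPair]; omega
  have hqXP : ∀ n, 4 * (Bud.XP pK oK).eval n + A'.coins.eval ((Bud.XP pK oK).eval n) + 8 ≤ q.eval n := fun n => by
    simp only [hq, Bud.qPoly, eval_add, eval_comp, eval_mul, eval_C, eval_X]; omega
  have hR'B : ∀ (n : ℕ) (s r : List Bool), r.length = q.eval n → ∀ r₀ : List Bool, r₀.length = pK.eval n →
      Atk.T' S A' n r₀ ≤ R.eval (boolPair (boolPair (unaryEncodeNat n) (boolPair s r)) ([] : List Bool)).length := by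
    intro n s r hr r₀ hr₀
    have h1 := hXP n r₀ hr₀; have h2 := hzlen n s r; have h3 := hqXP n
    exact natPoly_eval_mono _ (by omega)
  have hcB : ∀ (n : ℕ) (s r : List Bool), r.length = q.eval n → ∀ r₀ : List Bool, r₀.length = pK.eval n →
      ∀ rA : List Bool, rA.length = Atk.cA S A' n r₀ → ∀ qy : List Bool, A'.alg.step (boolPair (Atk.xA' S n r₀) rA) [] = Sum.inl qy →
        qy.length ≤ c.eval (boolPair (boolPair (unaryEncodeNat n) (boolPair s r)) ([] : List Bool)).length := by
    intro n s r hr r₀ hr₀ rA hrA qy h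
    have h1 := Bud.firstQuery_length_le A' hRA h
    have h2 := hXP n r₀ hr₀; have h3 := hzlen n s r; have h4 := hqXP n
    have h5 : rA.length ≤ A'.coins.eval ((Bud.XP pK oK).eval n) := by rw [hrA]; exact natPoly_eval_mono _ h2
    simp only [hc, Bud.cPoly, eval_comp, eval_mul, eval_C, eval_X]
    have := natPoly_eval_mono RA (show 4 * (Atk.xA' S n r₀).length + 2 * rA.length + 8 ≤
      4 * (boolPair (boolPair (unaryEncodeNat n) (boolPair s r)) ([] : List Bool)).length by omega)
    omega
  have hq1 : ∀ (n : ℕ) (r₀ : List Bool), r₀.length = pK.eval n → ∀ (rA rI α₁ : List Bool), rI.length = pI.eval n →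
      pK.eval n + Atk.cA S A' n r₀ + pS.eval (pairCode (Atk.sk S n r₀, hashedMsg H (H.index.run n rI) α₁)).length ≤ q.eval n := by
    intro n r₀ hr₀ rA rI α₁ hrI
    have hs : (H.index.run n rI).length = n := by
      apply hlen n
      rw [HashCollection.indexPMF, RandAlg.outputPMF, PMF.support_map]
      have hl : rI.length = H.index.coinLen (unaryEncodeNat n).length := by
        rw [Complexity.unaryEncodeNat_eq_replicate, List.length_replicate, hpI, hrI]
      exact ⟨⟨rI, hl⟩, by rw [PMF.support_uniformOfFintype]; exact Set.mem_univ _, rfl⟩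
    have hsk := (Bud.key_length_le (S := S) hoK n r₀).2
    rw [hr₀] at hsk
    have hh : (H.hash (H.index.run n rI) α₁).length ≤ ph.eval (2 * n + 2) := by
      have h0 := Bud.hash_length_le (H := H) hph (H.index.run n rI) []
      rw [hH.2.1 (H.index.run n rI) α₁, ← hH.2.1 (H.index.run n rI) []]
      rw [hs, List.length_nil, Nat.add_zero] at h0
      exact h0
    have hm : (pairCode (Atk.sk S n r₀, hashedMsg H (H.index.run n rI) α₁)).length ≤ (Bud.MP pK oK ph).eval n := by
      rw [Bud.length_pairCode, hashedMsg, length_boolPair, hs]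
      simp only [Bud.MP, eval_add, eval_comp, eval_mul, eval_C, eval_X]
      omega
    have h1 := natPoly_eval_mono pS hm
    have h2 : Atk.cA S A' n r₀ ≤ A'.coins.eval ((Bud.XP pK oK).eval n) := natPoly_eval_mono _ (hXP n r₀ hr₀)
    simp only [hq, Bud.qPoly, eval_add, eval_comp, eval_mul, eval_C, eval_X] at h2 ⊢
    omega
  -- the domination
  have hdom : ∀ n, oneTimeForgeProb (scheme H S pI pS fun N => (Bud.CP pI pS oI ph).eval N) A' n ≤
      S.restrictedOneTimeForgeProb ℓ A n + H.tcrProb (fun n => q.eval n) (FB.A0 S pK q A') B' n := fun n =>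
    (Pr.forgeProb_le_P1_add_P2 H S pI pS _ A' n).trans (add_le_add
      (Pr.P1_le hℓ hH.2.1 hpI hpS hlen hCL' hR'A hcA' hCAb n)
      (Pr.P2_le hpI hpK hCL' (Bud.qPoly_strictMono pS pK A' oK ph) (Bud.le_qPoly pS pK A' oK ph) hR'B hcB hq1 n))
  refine (hnegA.add hnegB).trans_eventually_abs_le (Eventually.of_forall fun n => ?_)
  simp only [Function.comp_apply, Pi.add_apply]
  rw [abs_of_nonneg (oneTimeForgeProb_nonneg _ _ _),
    abs_of_nonneg (add_nonneg (S.restrictedOneTimeForgeProb_nonneg ℓ A n) (H.tcrProb_nonneg _ _ _ n))]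
  exact hdom n

end Main

/-- **One-way functions + UOWHF ⇒ secure one-time signatures (Goldreich's route to Theorem 6.4.32, one-time
level).** From any one-way function (via the Lamport-type `ℓ`-restricted one-time scheme, Cor. 6.4.6) and
any universal one-way hash family with polynomial range specifier `ℓ'`, indices of length `n` and a
polynomial index-coin budget, Construction 6.4.30 yields a secure one-time signature scheme. (The remaining
steps of Thm 6.4.32/6.4.1 — UOWHF from OWF (Rompel, Thm 6.4.29) and one-time ⇒ general (Cor. 6.4.17 via
authentication trees and PRFs) — are not formalised here.) [Goldreich 2004, Prop. 6.4.31 with Cor. 6.4.6]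
[cite: Goldreich2004, Prop. 6.4.31] -/
theorem exists_isOneTimeSecure_of_OWFExist_of_isUOWHF (hOWF : OWFExist) {H : HashCollection} {ℓ'p pI : Polynomial ℕ}
    (hH : H.IsUOWHF fun n => ℓ'p.eval n) (hpI : ∀ n, H.index.coinLen n = pI.eval n)
    (hlen : ∀ n, ∀ s ∈ (H.indexPMF n).support, s.length = n) : ∃ S' : SignatureScheme, S'.IsOneTimeSecure := by
  obtain ⟨f, hf⟩ := hOWF
  have hℓ0 : (C 2 * X + C 2 + ℓ'p : Polynomial ℕ) ≠ 0 := fun h => by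
    have := congrArg (fun p : Polynomial ℕ => p.eval 0) h
    simp at this
  have hS := Lamport.scheme_isRestrictedOneTimeSecure hf hℓ0
  obtain ⟨CL, hCL⟩ := isOneTimeSecure (H := H) (S := Lamport.scheme f (C 2 * X + C 2 + ℓ'p)) (pI := pI) (pS := 0)
    (pK := C 2 * (C 2 * X + C 2 + ℓ'p) * X) (ℓ := fun n => (C 2 * X + C 2 + ℓ'p).eval n) (ℓ' := fun n => ℓ'p.eval n)
    (fun n => by simp) hpI (fun _ => by simp [Lamport.scheme]) (fun n => by simp [Lamport.scheme]; try ring) hlen hH hS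
  exact ⟨_, hCL⟩

end HashSign

end Literature.Computability.Cryptography
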